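import Literature.Topology.FourManifolds.DehnSurgeryTwistProofs
import Literature.Topology.FourManifolds.KirbyMoves
import Mathlib.Geometry.Manifold.PartitionOfUnity
import HarnessLib

/-!
# The flat model of the blow-down move: `±1`-surgery on the flat unit circle in `ℝ³`, relative to the disc

Topic `Literature/Topology/FourManifolds`; second step (after `KirbyMovesShrinkProofs.lean`)
towards the discharge of leaf **(C)** `Literature.Topology.FourManifolds.Knot.blowDownModel`
(`KirbyMovesBlowDown.lean`) of the blow-down invariance of surgery
(`Literature.Topology.FourManifolds.FramedLink.IsBlowDown.isSurgery`; R. C. Kirby, *The Topology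
of 4-Manifolds*, LNM 1374 (1989), Ch. I §5, Thm. 5.1, move (2): removing an isolated `±1`-framed
unknotted circle does not change `∂M_L`). Leaf (C) says: `S³` is `ε`-surgery (`ε = ±1`) on any
knot `K` bounding a smooth disc, presented with a tubular neighbourhood of framing `ε` inside a
prescribed neighbourhood `W` of the disc and gluing maps that are standard off `W`. Its
3-dimensional content (Rolfsen, *Knots and Links* (1976), §9.H: the `∓1` twist along a disc
spanning an unknot identifies `S³_{±1}(O)` with `S³`; Gompf–Stipsicz (1999), §5.1, Fig. 5.12)
is proved here in a **flat model** in `ℝ³`, entirely explicitly; the transport to `S³` along a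
chart flattening the given disc is the next file. Everything in this file is proved.

## The model (coordinates `p = (x, y, z)`, `a = (x² + y² - 1)/2`, flat circle `U = {a = z = 0}`)

* `flatTube h δ u w = (√(1 + 2 h (σ_δ w)₁) · u, (σ_δ w)₀)` (`h = ±1` a handedness, `σ_δ` the
  squeeze map of `ℝ²` onto the `δ`-disc, `DehnSurgeryTubularNbhdProofs.lean`): a tube around `U`
  with transverse coordinates `(a, z) = fieldDir h (σ_δ w) = (h (σ_δ w)₁, (σ_δ w)₀)`
  (`az_flatTube`); it is a partial diffeomorphism `S¹ × ℝ² ≅ {‖(a, z)‖ < δ}` with explicit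
  inverse (`flatTubePD`, `isLocalDiffeomorph_flatTubeS`, `flatTubeS_injective`).
* The **twist field**. For a cut-off `σ : ℝ³ → [0, 1]` (a `Cutoff`: rotation invariant about the
  `z`-axis, `0` on the flat disc and on the `δ`-tube, `1` off a support region)
  `F = (1 - σ) (a, z) + σ (1, 0)` vanishes exactly on `U` (`Cutoff.field_eq_zero_iff`: a zero has
  `z = 0`, `a ≤ 0`, hence lies on the disc where `σ = 0`, hence `a = 0`), and the **twist map**
  `T_s (x, y, z) = (R_{s ∠F̂} (x, y), z)` (`twistMap`, rotation of the horizontal part by the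
  angle of `F̂ = F/‖F‖`, sign `s = ±1`) preserves `(x² + y², z)`, hence `σ` and `F`, so that
  `T_{-s}` is its inverse off `U` (`Cutoff.twistMap_neg_twistMap`); it is the identity where
  `σ = 1` and smooth off `U`. Near `U` (`σ = 0`) it rotates by `s` times the polar angle of
  `(a, z)` — the "swap" identifying the surgered tube with a tube; across the disc it is the
  `∓1` twist; no angle functions are needed.
* The **key identity** (`fibreRot_fieldDir_eq_coreDir`, `twistMap_twistedTube`): for the twisted
  tube `ν_ε (u, w) = flatTube h δ u (fibreRot ε u w)` (fibre rotated by `ε` times the angle of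
  `u`, the framing-`ε` tube after transport) and `s = h ε`,
  `T_s (ν_ε (u, t v)) = ψ (t u, v)` with `ψ (p, v) = flatTube h δ (coreDir h ε v) (fibreRot ε p v)`
  (`psiFlat`) — a smooth reparametrised tube around the same circle, smooth across `p = 0`.
  Hence the surgery relation `T_s a = ψ (t u, v) ↔ a = ν_ε (u, t v)` (`twistMap_eq_psiFlat_iff`)
  and the covering `ℝ³ = T_s (ℝ³ ∖ U) ∪ ψ ({0} × S¹)` (`exists_eq_twistMap_or`).
* `ψ` is an injective local diffeomorphism of the open solid torus (`isLocalDiffeomorph_psiFlatS`,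
  via the partial diffeomorphism `torusTwistPD : D̊² × S¹ ≅ {‖w‖ < 1} ⊆ ℝ² × S¹`).
* `exists_cutoff`: every open `W ⊇` flat closed unit disc contains the compact support region of
  a smooth admissible cut-off of some thickness `0 < δ ≤ 1/4` (a smooth Urysohn function of
  `(x² + y², z)`, Mathlib's `exists_contMDiffMap_one_nhds_of_subset_interior`).

## References

* R. C. Kirby, *The Topology of 4-Manifolds*, LNM 1374, Springer (1989), Ch. I §5, Thm. 5.1,
  move (2). [cite: Kirby1989, Ch. I §5 Thm 5.1]
* D. Rolfsen, *Knots and Links*, Publish or Perish (1976), §9.H. [cite: Rolfsen1976, §9.F]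
* R. E. Gompf, A. I. Stipsicz, *4-Manifolds and Kirby Calculus* (1999), §5.1 (blowing down,
  Fig. 5.12), §5.3. [cite: GompfStipsicz1999, §5.3]

## Design notes

* All maps are explicit and polynomial/radical in the coordinates; the only non-constructive
  input is the smooth Urysohn function in `exists_cutoff`.
* The handedness `h` and the rotation sign `s = h ε` are kept as real parameters with
  `h² = ε² = 1`; the transport file picks `h` by the orientation of the flattening chart.
* The finite-dimensionality `Fact`s of `DehnSurgeryTubularNbhdProofs.lean` are local instances,
  as there. Declarations live in the sub-namespace `BlowDownFlat` (a model, §2 of CONVENTIONS).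
* No declaration in this file uses `sorry`.
-/

open scoped Manifold ContDiff Topology
open Function Set

noncomputable section

namespace Literature.Topology.FourManifolds

/-- Local notation: `𝔼 n` is the model Euclidean space `EuclideanSpace ℝ (Fin n)`. -/
local notation "𝔼 " n:arg => EuclideanSpace ℝ (Fin n)

/-- Local notation: `𝕊 n` is the unit sphere in `EuclideanSpace ℝ (Fin (n + 1))`. -/
local notation "𝕊 " n:arg => (Metric.sphere (0 : EuclideanSpace ℝ (Fin (n + 1))) 1)

namespace BlowDownFlat

attribute [local instance] fact_finrank_euclideanSpace_two fact_finrank_euclideanSpace_four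

/-! ### Coordinates on `ℝ³` -/

/-- The horizontal part `(x, y)` of a point `(x, y, z)` of `ℝ³`. [folklore] -/
def xy (p : 𝔼 3) : 𝔼 2 := !₂[p 0, p 1]

/-- First coordinate of `xy`. [folklore] -/
@[simp] theorem xy_apply_zero (p : 𝔼 3) : xy p 0 = p 0 := rfl
/-- Second coordinate of `xy`. [folklore] -/
@[simp] theorem xy_apply_one (p : 𝔼 3) : xy p 1 = p 1 := rfl

/-- The point of `ℝ³` with horizontal part `v` and height `z`. [folklore] -/
def mk3 (v : 𝔼 2) (z : ℝ) : 𝔼 3 := !₂[v 0, v 1, z]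

/-- First coordinate of `mk3`. [folklore] -/
@[simp] theorem mk3_apply_zero (v : 𝔼 2) (z : ℝ) : mk3 v z 0 = v 0 := rfl
/-- Second coordinate of `mk3`. [folklore] -/
@[simp] theorem mk3_apply_one (v : 𝔼 2) (z : ℝ) : mk3 v z 1 = v 1 := rfl
/-- Third coordinate of `mk3`. [folklore] -/
@[simp] theorem mk3_apply_two (v : 𝔼 2) (z : ℝ) : mk3 v z 2 = z := rfl

/-- `xy ∘ mk3` recovers the horizontal part. [folklore] -/
@[simp] theorem xy_mk3 (v : 𝔼 2) (z : ℝ) : xy (mk3 v z) = v := by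
  ext i; fin_cases i <;> rfl

/-- A point is `mk3` of its horizontal part and its height. [folklore] -/
@[simp] theorem mk3_xy (p : 𝔼 3) : mk3 (xy p) (p 2) = p := by
  ext i; fin_cases i <;> rfl

/-- The radial level function `a = (x² + y² - 1) / 2` of `ℝ³`, vanishing exactly on the unit
cylinder; `(a, z)` are the transverse coordinates to the flat unit circle. [folklore] -/
def aFun (p : 𝔼 3) : ℝ := (p 0 ^ 2 + p 1 ^ 2 - 1) / 2

/-- The transverse coordinates `(a, z)` of a point of `ℝ³`. [folklore] -/
def az (p : 𝔼 3) : 𝔼 2 := !₂[aFun p, p 2]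

/-- First transverse coordinate: the level `a`. [folklore] -/
@[simp] theorem az_apply_zero (p : 𝔼 3) : az p 0 = aFun p := rfl
/-- Second transverse coordinate: the height `z`. [folklore] -/
@[simp] theorem az_apply_one (p : 𝔼 3) : az p 1 = p 2 := rfl

/-- The flat unit circle `u ↦ (u, 0)` of `ℝ³`. [folklore] -/
def flatCircle (u : 𝕊 1) : 𝔼 3 := mk3 u 0

/-- `u₀² + u₁² = 1` on the unit circle. [folklore] -/
theorem sphere_sq (u : 𝕊 1) : (u : 𝔼 2) 0 ^ 2 + (u : 𝔼 2) 1 ^ 2 = 1 := by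
  rw [← norm_sq_eq_of_fin_two, norm_eq_of_mem_sphere u, one_pow]

/-! ### The key rotation identity -/

/-- The direction of the transverse coordinates of the flat tube of handedness `h` at the fibre
point `w`: `(h w₁, w₀)`. [folklore] -/
def fieldDir (h : ℝ) (w : 𝔼 2) : 𝔼 2 := !₂[h * w 1, w 0]

/-- First coordinate of `fieldDir`. [folklore] -/
@[simp] theorem fieldDir_apply_zero (h : ℝ) (w : 𝔼 2) : fieldDir h w 0 = h * w 1 := rfl
/-- Second coordinate of `fieldDir`. [folklore] -/
@[simp] theorem fieldDir_apply_one (h : ℝ) (w : 𝔼 2) : fieldDir h w 1 = w 0 := rfl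

/-- The core direction `(h v₁, h ε v₀)` of the new solid torus. [folklore] -/
def coreDir (h ε : ℝ) (v : 𝔼 2) : 𝔼 2 := !₂[h * v 1, h * ε * v 0]

/-- First coordinate of `coreDir`. [folklore] -/
@[simp] theorem coreDir_apply_zero (h ε : ℝ) (v : 𝔼 2) : coreDir h ε v 0 = h * v 1 := rfl
/-- Second coordinate of `coreDir`. [folklore] -/
@[simp] theorem coreDir_apply_one (h ε : ℝ) (v : 𝔼 2) : coreDir h ε v 1 = h * ε * v 0 := rfl

/-- **The key identity of the blow-down model.** Rotating the core coordinate `u` by the field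
direction at the twisted fibre point `fibreRot ε u v`, with sign `h ε`, kills the dependence on
`u`: the result is the core direction `(h v₁, h ε v₀)` of `v` alone. [folklore] -/
theorem fibreRot_fieldDir_eq_coreDir {h ε : ℝ} (he : ε ^ 2 = 1) (u : 𝕊 1)
    (v : 𝔼 2) :
    fibreRot (h * ε) (fieldDir h (fibreRot ε (u : 𝔼 2) v)) (u : 𝔼 2) = coreDir h ε v := by
  have hu := sphere_sq u
  ext i
  fin_cases i
  · simp
    linear_combination (h * v 1) * hu + (h * (u : 𝔼 2) 1 ^ 2 * v 1) * he
  · simp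
    linear_combination (h * ε * v 0) * hu + (-(h * (u : 𝔼 2) 0 * (u : 𝔼 2) 1 * v 1)) * he


/-! ### Norms of the rotations -/

/-- A coordinate is bounded by the norm (`ℝ²`). [folklore] -/
theorem abs_apply_le_norm_two (w : 𝔼 2) (i : Fin 2) : |w i| ≤ ‖w‖ := by
  have h1 : w i ^ 2 ≤ ‖w‖ ^ 2 := by
    rw [norm_sq_eq_of_fin_two]
    fin_cases i <;> simp <;> nlinarith
  exact abs_le_of_sq_le_sq' h1 (norm_nonneg _) |>.elim (fun h h' ↦ abs_le.2 ⟨h, h'⟩)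

/-- `‖fieldDir h w‖ = ‖w‖` for `h² = 1`. [folklore] -/
theorem norm_fieldDir {h : ℝ} (hh : h ^ 2 = 1) (w : 𝔼 2) : ‖fieldDir h w‖ = ‖w‖ := by
  have h1 : ‖fieldDir h w‖ ^ 2 = ‖w‖ ^ 2 := by
    rw [norm_sq_eq_of_fin_two, norm_sq_eq_of_fin_two, fieldDir_apply_zero, fieldDir_apply_one]
    linear_combination (w 1 ^ 2) * hh
  nlinarith [norm_nonneg (fieldDir h w), norm_nonneg w]

/-- `‖coreDir h ε v‖ = ‖v‖` for `h² = ε² = 1`. [folklore] -/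
theorem norm_coreDir {h ε : ℝ} (hh : h ^ 2 = 1) (he : ε ^ 2 = 1) (v : 𝔼 2) :
    ‖coreDir h ε v‖ = ‖v‖ := by
  have h1 : ‖coreDir h ε v‖ ^ 2 = ‖v‖ ^ 2 := by
    rw [norm_sq_eq_of_fin_two, norm_sq_eq_of_fin_two, coreDir_apply_zero, coreDir_apply_one]
    linear_combination (v 1 ^ 2 + ε ^ 2 * v 0 ^ 2) * hh + (v 0 ^ 2) * he
  nlinarith [norm_nonneg (coreDir h ε v), norm_nonneg v]

/-- `‖fibreRot σ u w‖ = ‖u‖ ‖w‖` for `σ² = 1` (complex multiplication). [folklore] -/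
theorem norm_fibreRot {σ : ℝ} (hσ : σ ^ 2 = 1) (u w : 𝔼 2) :
    ‖fibreRot σ u w‖ = ‖u‖ * ‖w‖ := by
  have h1 : ‖fibreRot σ u w‖ ^ 2 = (‖u‖ * ‖w‖) ^ 2 := by
    rw [mul_pow, norm_sq_eq_of_fin_two, norm_sq_eq_of_fin_two, norm_sq_eq_of_fin_two, fibreRot_apply_zero,
      fibreRot_apply_one]
    linear_combination (u 1 ^ 2 * w 1 ^ 2 + u 1 ^ 2 * w 0 ^ 2) * hσ
  nlinarith [norm_nonneg (fibreRot σ u w), norm_nonneg u, norm_nonneg w,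
    mul_nonneg (norm_nonneg u) (norm_nonneg w)]

/-- On the unit circle `fibreRot σ u` (`σ² = 1`) preserves norms. [folklore] -/
theorem norm_fibreRot_sphere {σ : ℝ} (hσ : σ ^ 2 = 1) (u : 𝕊 1) (w : 𝔼 2) :
    ‖fibreRot σ (u : 𝔼 2) w‖ = ‖w‖ := by
  rw [norm_fibreRot hσ, norm_eq_of_mem_sphere u, one_mul]

/-- `fibreRot σ u w` is linear in `u` as well: scaling `u`. [folklore] -/
theorem fibreRot_smul_left (σ : ℝ) (r : ℝ) (u w : 𝔼 2) :
    fibreRot σ (r • u) w = r • fibreRot σ u w := by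
  ext i; fin_cases i <;> simp <;> ring

/-- `fieldDir` commutes with scalars. [folklore] -/
theorem fieldDir_smul (h r : ℝ) (w : 𝔼 2) : fieldDir h (r • w) = r • fieldDir h w := by
  ext i; fin_cases i <;> simp; ring

/-! ### The flat tube around the unit circle -/

section Tube

variable (h δ : ℝ)

/-- The radius `R(w) = √(1 + 2 h (σ_δ w)₁)` at which the flat tube places the fibre point `w`
(so that the level `a = (r² - 1)/2` of the tube point is `h (σ_δ w)₁`). [folklore] -/
def tubeRadius (w : 𝔼 2) : ℝ := Real.sqrt (1 + 2 * (h * squeeze δ w 1))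

/-- **The flat tube** of handedness `h = ±1` and thickness `δ` around the unit circle of the
plane `z = 0` in `ℝ³`: `(u, w) ↦ (R(w) u, (σ_δ w)₀)`, `R(w) = √(1 + 2 h (σ_δ w)₁)`, where `σ_δ`
is the squeeze map of `ℝ²` onto the disc of radius `δ`; its transverse coordinates are
`(a, z) = (h (σ_δ w)₁, (σ_δ w)₀)`. Stated for an arbitrary core vector `u : ℝ²` (a unit vector
in all applications). [folklore] -/
def flatTube (u w : 𝔼 2) : 𝔼 3 := mk3 (tubeRadius h δ w • u) (squeeze δ w 0)

variable {h δ}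

/-- The coordinates of the squeeze map are bounded by `δ`. [folklore] -/
theorem abs_squeeze_apply_lt (hδ : 0 < δ) (w : 𝔼 2) (i : Fin 2) : |squeeze δ w i| < δ :=
  (abs_apply_le_norm_two _ i).trans_lt (norm_squeeze_lt hδ w)

/-- The radicand of `tubeRadius` is at least `1/2` for `h² = 1`, `δ ≤ 1/4`. [folklore] -/
theorem half_le_radicand (hh : h ^ 2 = 1) (hδ : 0 < δ) (hδ4 : δ ≤ 1 / 4) (w : 𝔼 2) :
    1 / 2 ≤ 1 + 2 * (h * squeeze δ w 1) := by
  have h1 := abs_squeeze_apply_lt hδ w 1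
  have habs : |h| = 1 := by
    rcases sq_eq_one_iff.1 hh with rfl | rfl <;> simp
  have h2 : |h * squeeze δ w 1| < δ := by rw [abs_mul, habs, one_mul]; exact h1
  have h3 := (abs_lt.1 h2).1
  linarith

/-- The tube radius is positive. [folklore] -/
theorem tubeRadius_pos (hh : h ^ 2 = 1) (hδ : 0 < δ) (hδ4 : δ ≤ 1 / 4) (w : 𝔼 2) :
    0 < tubeRadius h δ w :=
  Real.sqrt_pos.2 (lt_of_lt_of_le (by norm_num) (half_le_radicand hh hδ hδ4 w))

/-- The square of the tube radius. [folklore] -/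
theorem tubeRadius_sq (hh : h ^ 2 = 1) (hδ : 0 < δ) (hδ4 : δ ≤ 1 / 4) (w : 𝔼 2) :
    tubeRadius h δ w ^ 2 = 1 + 2 * (h * squeeze δ w 1) :=
  Real.sq_sqrt (le_trans (by norm_num) (half_le_radicand hh hδ hδ4 w))

/-- The horizontal part of a flat tube point. [folklore] -/
@[simp] theorem xy_flatTube (u w : 𝔼 2) : xy (flatTube h δ u w) = tubeRadius h δ w • u := by
  simp [flatTube]

/-- The height of a flat tube point. [folklore] -/
@[simp] theorem flatTube_apply_two (u w : 𝔼 2) : flatTube h δ u w 2 = squeeze δ w 0 := rfl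

/-- **The transverse coordinates of the flat tube** over a unit core vector:
`(a, z) = fieldDir h (σ_δ w)`. [folklore] -/
theorem az_flatTube (hh : h ^ 2 = 1) (hδ : 0 < δ) (hδ4 : δ ≤ 1 / 4) (u : 𝕊 1) (w : 𝔼 2) :
    az (flatTube h δ u w) = fieldDir h (squeeze δ w) := by
  have hR := tubeRadius_sq hh hδ hδ4 w
  have hu := sphere_sq u
  ext i
  fin_cases i
  · simp [aFun, flatTube]
    -- ((R u₀)² + (R u₁)² - 1)/2 = h c₁
    have : (tubeRadius h δ w * (u : 𝔼 2) 0) ^ 2 + (tubeRadius h δ w * (u : 𝔼 2) 1) ^ 2 =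
        tubeRadius h δ w ^ 2 := by
      linear_combination (tubeRadius h δ w ^ 2) * hu
    rw [this, hR]
    ring
  · rfl

/-- The norm of the transverse coordinates of the flat tube over a unit core vector is the norm
of the squeezed fibre coordinate, hence `< δ`. [folklore] -/
theorem norm_az_flatTube (hh : h ^ 2 = 1) (hδ : 0 < δ) (hδ4 : δ ≤ 1 / 4) (u : 𝕊 1) (w : 𝔼 2) :
    ‖az (flatTube h δ u w)‖ = ‖squeeze δ w‖ := by
  rw [az_flatTube hh hδ hδ4, norm_fieldDir hh]

end Tube

/-! ### The twist field and the twist map -/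

section Twist

variable (σ : 𝔼 3 → ℝ)

/-- The unit vector `e₀ = (1, 0)` of the plane. [folklore] -/
def e0 : 𝔼 2 := !₂[1, 0]

/-- First coordinate of `e₀`. [folklore] -/
@[simp] theorem e0_apply_zero : e0 0 = 1 := rfl
/-- Second coordinate of `e₀`. [folklore] -/
@[simp] theorem e0_apply_one : e0 1 = 0 := rfl

/-- **The twist field** (unnormalised) `F = (1 - σ) (a, z) + σ (1, 0)` of a cut-off function
`σ`: the transverse coordinates `(a, z)` near the flat disc (`σ = 0`), the constant `(1, 0)`
away from it (`σ = 1`). [folklore] -/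
def field (p : 𝔼 3) : 𝔼 2 := (1 - σ p) • az p + σ p • e0

/-- **The normalised twist field** `B̂ = F / ‖F‖` (junk `0` where `F = 0`, i.e. on the unit
circle for an admissible `σ`). [folklore] -/
def bhat (p : 𝔼 3) : 𝔼 2 := ‖field σ p‖⁻¹ • field σ p

/-- **The twist map** of sign `s`: rotate the horizontal part of `p` by the normalised twist
field, `T_s (x, y, z) = (R_{s ∠B̂(p)} (x, y), z)`. [folklore] -/
def twistMap (s : ℝ) (p : 𝔼 3) : 𝔼 3 := mk3 (fibreRot s (bhat σ p) (xy p)) (p 2)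

variable {σ}

/-- Where the cut-off vanishes the twist field is the transverse coordinate vector. [folklore] -/
theorem field_of_eq_zero {p : 𝔼 3} (hp : σ p = 0) : field σ p = az p := by
  simp [field, hp]

/-- Where the cut-off is `1` the twist field is `e₀`. [folklore] -/
theorem field_of_eq_one {p : 𝔼 3} (hp : σ p = 1) : field σ p = e0 := by
  simp [field, hp]

/-- The normalised field of a nonzero field value is a unit vector. [folklore] -/
theorem norm_bhat {p : 𝔼 3} (hp : field σ p ≠ 0) : ‖bhat σ p‖ = 1 := by
  rw [bhat, norm_smul, norm_inv, norm_norm, inv_mul_cancel₀ (norm_ne_zero_iff.2 hp)]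

/-- Where the cut-off is `1` the normalised field is `e₀`. [folklore] -/
theorem bhat_of_eq_one {p : 𝔼 3} (hp : σ p = 1) : bhat σ p = e0 := by
  have : ‖e0‖ = 1 := by
    rw [EuclideanSpace.norm_eq]; simp [Fin.sum_univ_two, e0]
  rw [bhat, field_of_eq_one hp, this, inv_one, one_smul]

/-- Rotating by `e₀` is the identity. [folklore] -/
theorem fibreRot_e0 (s : ℝ) (w : 𝔼 2) : fibreRot s e0 w = w := by
  ext i; fin_cases i <;> simp

/-- **Where the cut-off is `1` the twist map is the identity.** [folklore] -/
theorem twistMap_of_eq_one (s : ℝ) {p : 𝔼 3} (hp : σ p = 1) : twistMap σ s p = p := by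
  rw [twistMap, bhat_of_eq_one hp, fibreRot_e0, mk3_xy]

/-- The height is unchanged by the twist map. [folklore] -/
@[simp] theorem twistMap_apply_two (s : ℝ) (p : 𝔼 3) : twistMap σ s p 2 = p 2 := rfl

/-- The horizontal part of the twist map. [folklore] -/
@[simp] theorem xy_twistMap (s : ℝ) (p : 𝔼 3) :
    xy (twistMap σ s p) = fibreRot s (bhat σ p) (xy p) := by
  simp [twistMap]

/-- `x² + y²` in terms of the horizontal part. [folklore] -/
theorem sq_add_sq_eq_norm_xy_sq (p : 𝔼 3) : p 0 ^ 2 + p 1 ^ 2 = ‖xy p‖ ^ 2 := by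
  rw [norm_sq_eq_of_fin_two]; rfl

/-- **The twist map preserves `x² + y²`** (it rotates the horizontal part) wherever the field
is nonzero (`s² = 1`). [folklore] -/
theorem sq_add_sq_twistMap {s : ℝ} (hs : s ^ 2 = 1) {p : 𝔼 3} (hp : field σ p ≠ 0) :
    twistMap σ s p 0 ^ 2 + twistMap σ s p 1 ^ 2 = p 0 ^ 2 + p 1 ^ 2 := by
  rw [sq_add_sq_eq_norm_xy_sq, sq_add_sq_eq_norm_xy_sq, xy_twistMap, norm_fibreRot hs,
    norm_bhat hp, one_mul]

/-- The twist map preserves the level function `a`. [folklore] -/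
theorem aFun_twistMap {s : ℝ} (hs : s ^ 2 = 1) {p : 𝔼 3} (hp : field σ p ≠ 0) :
    aFun (twistMap σ s p) = aFun p := by
  rw [aFun, aFun, sq_add_sq_twistMap hs hp]

/-- The twist map preserves the transverse coordinates `(a, z)`. [folklore] -/
theorem az_twistMap {s : ℝ} (hs : s ^ 2 = 1) {p : 𝔼 3} (hp : field σ p ≠ 0) :
    az (twistMap σ s p) = az p := by
  ext i; fin_cases i
  · exact aFun_twistMap hs hp
  · rfl

end Twist

/-! ### The flat circle -/

/-- A point of the flat circle has `x² + y² = 1` and `z = 0`. [folklore] -/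
theorem flatCircle_mem (u : 𝕊 1) :
    (flatCircle u) 0 ^ 2 + (flatCircle u) 1 ^ 2 = 1 ∧ (flatCircle u) 2 = 0 :=
  ⟨sphere_sq u, rfl⟩

/-- `x² + y² = 1 ∧ z = 0` describes exactly the flat circle. [folklore] -/
theorem mem_range_flatCircle_iff (p : 𝔼 3) :
    p ∈ range flatCircle ↔ p 0 ^ 2 + p 1 ^ 2 = 1 ∧ p 2 = 0 := by
  constructor
  · rintro ⟨u, rfl⟩; exact flatCircle_mem u
  · rintro ⟨hr, hz⟩
    have hmem : xy p ∈ Metric.sphere (0 : 𝔼 2) 1 := by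
      rw [mem_sphere_zero_iff_norm, ← Real.sqrt_sq (norm_nonneg _), ← sq_add_sq_eq_norm_xy_sq, hr,
        Real.sqrt_one]
    refine ⟨⟨xy p, hmem⟩, ?_⟩
    rw [flatCircle]
    change mk3 (xy p) 0 = p
    rw [← hz, mk3_xy]

/-! ### Admissible cut-off functions -/

/-- An **admissible cut-off** for the flat blow-down model of thickness `δ`: a function
`σ : ℝ³ → [0, 1]` which only depends on `(x² + y², z)` (rotation invariance about the
`z`-axis), vanishes on the flat closed unit disc and on the tube `‖(a, z)‖ < δ` around the unit
circle, and equals `1` off a set `supp` (the support region, itself rotation invariant).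
Smoothness and compactness are recorded separately where needed. [folklore] -/
structure Cutoff (δ : ℝ) where
  /-- The cut-off function. -/
  σ : 𝔼 3 → ℝ
  /-- The support region off which `σ = 1`. -/
  supp : Set (𝔼 3)
  nonneg : ∀ p, 0 ≤ σ p
  le_one : ∀ p, σ p ≤ 1
  rot : ∀ p q : 𝔼 3, p 0 ^ 2 + p 1 ^ 2 = q 0 ^ 2 + q 1 ^ 2 → p 2 = q 2 → σ p = σ q
  supp_rot : ∀ p q : 𝔼 3, p 0 ^ 2 + p 1 ^ 2 = q 0 ^ 2 + q 1 ^ 2 → p 2 = q 2 → p ∈ supp → q ∈ supp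
  eq_zero_of_disc : ∀ p : 𝔼 3, p 2 = 0 → p 0 ^ 2 + p 1 ^ 2 ≤ 1 → σ p = 0
  eq_zero_of_tube : ∀ p : 𝔼 3, ‖az p‖ < δ → σ p = 0
  eq_one : ∀ p ∉ supp, σ p = 1

namespace Cutoff

variable {δ : ℝ} (C : Cutoff δ)

/-- **The twist field of an admissible cut-off vanishes only on the unit circle.** If
`F(p) = 0` then `(1 - σ) z = 0` and `(1 - σ) a + σ = 0`; `σ = 1` is impossible, so `z = 0` and
`a = -σ/(1 - σ) ≤ 0`, i.e. `p` lies on the closed flat disc, where `σ = 0`, whence `a = 0`: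
`x² + y² = 1`, `z = 0`. [folklore] -/
theorem field_eq_zero_iff (p : 𝔼 3) :
    field C.σ p = 0 ↔ p 0 ^ 2 + p 1 ^ 2 = 1 ∧ p 2 = 0 := by
  constructor
  · intro h0
    have h0' : ∀ i, field C.σ p i = 0 := fun i ↦ by rw [h0]; rfl
    have hz : (1 - C.σ p) * p 2 = 0 := by simpa [field] using h0' 1
    have ha : (1 - C.σ p) * aFun p + C.σ p = 0 := by simpa [field] using h0' 0
    have hσ1 : C.σ p ≠ 1 := by
      intro h1; rw [h1] at ha; norm_num at ha
    have h1σ : 0 < 1 - C.σ p := sub_pos.2 (lt_of_le_of_ne (C.le_one p) hσ1)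
    have hz0 : p 2 = 0 := by
      rcases mul_eq_zero.1 hz with h | h
      · exact absurd h h1σ.ne'
      · exact h
    have ha0 : aFun p ≤ 0 := by nlinarith [C.nonneg p]
    have hdisc : p 0 ^ 2 + p 1 ^ 2 ≤ 1 := by unfold aFun at ha0; linarith
    have hσ0 := C.eq_zero_of_disc p hz0 hdisc
    rw [hσ0] at ha
    simp only [sub_zero, one_mul, add_zero] at ha
    unfold aFun at ha
    exact ⟨by linarith, hz0⟩
  · rintro ⟨hr, hz⟩
    have hσ0 := C.eq_zero_of_disc p hz hr.le
    have ha : aFun p = 0 := by unfold aFun; rw [hr]; ring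
    ext i; fin_cases i <;> simp [field, hσ0, ha, hz]

/-- Off the unit circle the field is nonzero. [folklore] -/
theorem field_ne_zero {p : 𝔼 3} (hp : ¬(p 0 ^ 2 + p 1 ^ 2 = 1 ∧ p 2 = 0)) :
    field C.σ p ≠ 0 := fun h ↦ hp ((C.field_eq_zero_iff p).1 h)

/-- **The twist map preserves the cut-off** (rotation invariance of `σ`), off the circle. [folklore] -/
theorem σ_twistMap {s : ℝ} (hs : s ^ 2 = 1) {p : 𝔼 3} (hp : p ∉ range flatCircle) :
    C.σ (twistMap C.σ s p) = C.σ p :=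
  C.rot _ _ (sq_add_sq_twistMap hs (C.field_ne_zero (mt (mem_range_flatCircle_iff p).2 hp))) rfl

/-- The twist map preserves the twist field, off the circle. [folklore] -/
theorem field_twistMap {s : ℝ} (hs : s ^ 2 = 1) {p : 𝔼 3} (hp : p ∉ range flatCircle) :
    field C.σ (twistMap C.σ s p) = field C.σ p := by
  have hF := C.field_ne_zero (mt (mem_range_flatCircle_iff p).2 hp)
  rw [field, field, C.σ_twistMap hs hp, az_twistMap hs hF]

/-- The twist map preserves the normalised twist field, off the circle. [folklore] -/
theorem bhat_twistMap {s : ℝ} (hs : s ^ 2 = 1) {p : 𝔼 3} (hp : p ∉ range flatCircle) :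
    bhat C.σ (twistMap C.σ s p) = bhat C.σ p := by
  rw [bhat, bhat, C.field_twistMap hs hp]

/-- The twist map maps the complement of the circle to itself. [folklore] -/
theorem twistMap_not_mem {s : ℝ} (hs : s ^ 2 = 1) {p : 𝔼 3} (hp : p ∉ range flatCircle) :
    twistMap C.σ s p ∉ range flatCircle := by
  have hF := C.field_ne_zero (mt (mem_range_flatCircle_iff p).2 hp)
  rw [mem_range_flatCircle_iff] at hp ⊢
  rwa [sq_add_sq_twistMap hs hF, twistMap_apply_two]

/-- The normalised field off the circle, as a point of the unit circle. [folklore] -/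
def bhatSphere {p : 𝔼 3} (hp : p ∉ range flatCircle) : 𝕊 1 :=
  ⟨bhat C.σ p, mem_sphere_zero_iff_norm.2
    (norm_bhat (C.field_ne_zero (mt (mem_range_flatCircle_iff p).2 hp)))⟩

/-- **The twist maps of opposite signs are inverse to each other** off the circle (`s² = 1`):
both rotate the horizontal part by the same field value, by opposite angles. [folklore] -/
theorem twistMap_neg_twistMap {s : ℝ} (hs : s ^ 2 = 1) {p : 𝔼 3} (hp : p ∉ range flatCircle) :
    twistMap C.σ (-s) (twistMap C.σ s p) = p := by
  rw [twistMap, C.bhat_twistMap hs hp, xy_twistMap, twistMap_apply_two]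
  have := fibreRot_neg_fibreRot_of_sq hs (C.bhatSphere hp) (xy p)
  change fibreRot (-s) (bhat C.σ p) (fibreRot s (bhat C.σ p) (xy p)) = xy p at this
  rw [this, mk3_xy]

/-- The twist map of sign `s` undoes that of sign `-s`, off the circle. [folklore] -/
theorem twistMap_twistMap_neg {s : ℝ} (hs : s ^ 2 = 1) {p : 𝔼 3} (hp : p ∉ range flatCircle) :
    twistMap C.σ s (twistMap C.σ (-s) p) = p := by
  have h := C.twistMap_neg_twistMap (s := -s) (by rw [neg_sq, hs]) hp
  rwa [neg_neg] at h

/-- **Off the support region the twist map is the identity.** [folklore] -/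
theorem twistMap_of_not_mem_supp (s : ℝ) {p : 𝔼 3} (hp : p ∉ C.supp) : twistMap C.σ s p = p :=
  twistMap_of_eq_one s (C.eq_one p hp)

/-- The twist map preserves the support region, off the circle. [folklore] -/
theorem twistMap_mem_supp_iff {s : ℝ} (hs : s ^ 2 = 1) {p : 𝔼 3} (hp : p ∉ range flatCircle) :
    twistMap C.σ s p ∈ C.supp ↔ p ∈ C.supp := by
  have hF := C.field_ne_zero (mt (mem_range_flatCircle_iff p).2 hp)
  have h1 := sq_add_sq_twistMap hs hF (σ := C.σ)
  exact ⟨fun h ↦ C.supp_rot _ _ h1 rfl h, fun h ↦ C.supp_rot _ _ h1.symm rfl h⟩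

end Cutoff


/-! ### The twisted tube, the new solid torus and the surgery relation -/

section Model

variable {δ : ℝ} (C : Cutoff δ) {h ε : ℝ}

/-- **The twisted flat tube** `ν_ε (u, w) = ν₀ʰ (u, R_{ε ∠u} w)`: the flat tube precomposed
with the fibre twist `fibreRot ε u` (after transport to `S³` this is `Knot.TubularNbhd.twist`,
turning the framing `0` of the flat tube into `ε`). [folklore] -/
def twistedTube (h ε δ : ℝ) (u w : 𝔼 2) : 𝔼 3 := flatTube h δ u (fibreRot ε u w)

/-- **The new solid torus of the flat model**: `ψ (p, v) = ν₀ʰ (coreDir h ε v, fibreRot ε p v)`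
— a reparametrised tube around the same flat circle, with core `v ↦ (h v₁, h ε v₀, 0)` and
meridian discs the images of the discs `p ↦ fibreRot ε p v`. [folklore] -/
def psiFlat (h ε δ : ℝ) (p v : 𝔼 2) : 𝔼 3 := flatTube h δ (coreDir h ε v) (fibreRot ε p v)

/-- The transverse coordinates of a twisted tube point over a unit vector do not vanish off the
zero section, so the point lies off the flat circle. [folklore] -/
theorem flatTube_not_mem_range (hh : h ^ 2 = 1) (hδ : 0 < δ) (hδ4 : δ ≤ 1 / 4) (u : 𝕊 1)
    {w : 𝔼 2} (hw : w ≠ 0) : flatTube h δ u w ∉ range flatCircle := by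
  rw [mem_range_flatCircle_iff]
  intro ⟨hr, hz⟩
  have haz : az (flatTube h δ u w) = 0 := by
    ext i; fin_cases i
    · simp [aFun, hr]
    · exact hz
  have hn := norm_az_flatTube hh hδ hδ4 u w
  rw [haz, norm_zero] at hn
  exact (squeeze_injective hδ).ne hw (by
    rw [squeeze_zero]; exact norm_eq_zero.1 hn.symm)

/-- **The key computation of the flat model.** For unit `u`, `v`, `t > 0` and an admissible
cut-off, the twist map of sign `h ε` carries the twisted-tube point over `u` at the fibre point
`t • v` to the `ψ`-point `(t • u, v)`:
`T_{hε} (ν_ε (u, t v)) = ψ (t u, v)`. At that point `σ = 0`, the field is the positive multiple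
`λ t • fieldDir h (fibreRot ε u v)` of a unit vector, and rotating the core `u` by it gives
`coreDir h ε v` (`fibreRot_fieldDir_eq_coreDir`). [folklore] -/
theorem twistMap_twistedTube (hh : h ^ 2 = 1) (he : ε ^ 2 = 1) (hδ : 0 < δ) (hδ4 : δ ≤ 1 / 4)
    (u v : 𝕊 1) {t : ℝ} (ht : 0 < t) :
    twistMap C.σ (h * ε) (twistedTube h ε δ u (t • (v : 𝔼 2))) =
      psiFlat h ε δ (t • (u : 𝔼 2)) v := by
  set w' : 𝔼 2 := fibreRot ε (u : 𝔼 2) v with hw'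
  set w : 𝔼 2 := fibreRot ε (u : 𝔼 2) (t • (v : 𝔼 2)) with hw
  have hww' : w = t • w' := by rw [hw, hw', fibreRot_smul]
  have hw'1 : ‖w'‖ = 1 := by rw [hw', norm_fibreRot_sphere he, norm_eq_of_mem_sphere v]
  set q := flatTube h δ u w with hq
  -- the cut-off vanishes at `q`
  have hσ : C.σ q = 0 := C.eq_zero_of_tube q (by
    rw [hq, norm_az_flatTube hh hδ hδ4]; exact norm_squeeze_lt hδ w)
  -- the field at `q`
  have hcpos : 0 < δ * squeezeFactor w * t := mul_pos (mul_pos hδ (squeezeFactor_pos w)) ht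
  have hF : field C.σ q = (δ * squeezeFactor w) • fieldDir h w := by
    rw [field_of_eq_zero hσ, hq, az_flatTube hh hδ hδ4, squeeze_def, fieldDir_smul]
  have hfd : fieldDir h w = t • fieldDir h w' := by rw [hww', fieldDir_smul]
  have hB : bhat C.σ q = fieldDir h w' := by
    rw [bhat, hF, hfd, smul_smul (δ * squeezeFactor w) t, norm_smul, Real.norm_of_nonneg hcpos.le,
      norm_fieldDir hh, hw'1, mul_one, smul_smul, inv_mul_cancel₀ hcpos.ne', one_smul]
  -- conclude
  change twistMap C.σ (h * ε) q = _
  rw [twistMap, hB, hq, xy_flatTube, fibreRot_smul, hw', fibreRot_fieldDir_eq_coreDir he,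
    flatTube_apply_two, psiFlat, flatTube, fibreRot_smul_left, ← hw', ← hww']

/-- `ψ` on the core: `ψ (0, v)` is the point `coreDir h ε v` of the flat circle. [folklore] -/
theorem psiFlat_zero (v : 𝔼 2) : psiFlat h ε δ 0 v = mk3 (coreDir h ε v) 0 := by
  rw [psiFlat, flatTube]
  have h0 : fibreRot ε (0 : 𝔼 2) v = 0 := by ext i; fin_cases i <;> simp
  rw [h0, squeeze_zero, tubeRadius, squeeze_zero]
  simp

/-- The inverse of `coreDir h ε` on the circle (`h² = ε² = 1`): `(h ε u₁, h u₀)`. [folklore] -/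
def coreInv (h ε : ℝ) (u : 𝔼 2) : 𝔼 2 := !₂[h * ε * u 1, h * u 0]

/-- `coreDir ∘ coreInv = id` for `h² = ε² = 1`. [folklore] -/
theorem coreDir_coreInv (hh : h ^ 2 = 1) (he : ε ^ 2 = 1) (u : 𝔼 2) :
    coreDir h ε (coreInv h ε u) = u := by
  ext i; fin_cases i <;> simp [coreInv]
  · linear_combination (u 0) * hh
  · linear_combination (ε ^ 2 * u 1) * hh + (u 1) * he

/-- `coreInv ∘ coreDir = id` for `h² = ε² = 1`. [folklore] -/
theorem coreInv_coreDir (hh : h ^ 2 = 1) (he : ε ^ 2 = 1) (v : 𝔼 2) :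
    coreInv h ε (coreDir h ε v) = v := by
  ext i; fin_cases i <;> simp [coreInv]
  · linear_combination (ε ^ 2 * v 0) * hh + (v 0) * he
  · linear_combination (v 1) * hh

/-- `‖coreInv h ε u‖ = ‖u‖` for `h² = ε² = 1`. [folklore] -/
theorem norm_coreInv (hh : h ^ 2 = 1) (he : ε ^ 2 = 1) (u : 𝔼 2) : ‖coreInv h ε u‖ = ‖u‖ := by
  have h1 : ‖coreInv h ε u‖ ^ 2 = ‖u‖ ^ 2 := by
    rw [norm_sq_eq_of_fin_two, norm_sq_eq_of_fin_two]
    simp [coreInv]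
    linear_combination (ε ^ 2 * u 1 ^ 2 + u 0 ^ 2) * hh + (u 1 ^ 2) * he
  nlinarith [norm_nonneg (coreInv h ε u), norm_nonneg u]

/-- The core of `ψ` covers the flat circle. [folklore] -/
theorem flatCircle_eq_psiFlat_zero (hh : h ^ 2 = 1) (he : ε ^ 2 = 1) (u : 𝕊 1) :
    flatCircle u = psiFlat h ε δ 0 (coreInv h ε u) := by
  rw [psiFlat_zero, coreDir_coreInv hh he]; rfl

/-- **The surgery relation of the flat model.** For `a` off the flat circle, unit `u`, `v` and
`t > 0`: `T_{hε} a = ψ (t u, v)` iff `a = ν_ε (u, t v)` (the "if" is the key computation, the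
"only if" follows by applying the inverse twist map `T_{-hε}`). [folklore] -/
theorem twistMap_eq_psiFlat_iff (hh : h ^ 2 = 1) (he : ε ^ 2 = 1) (hδ : 0 < δ) (hδ4 : δ ≤ 1 / 4)
    {a : 𝔼 3} (ha : a ∉ range flatCircle) (u v : 𝕊 1) {t : ℝ} (ht : 0 < t) :
    twistMap C.σ (h * ε) a = psiFlat h ε δ (t • (u : 𝔼 2)) v ↔
      a = twistedTube h ε δ u (t • (v : 𝔼 2)) := by
  have hs : (h * ε) ^ 2 = 1 := by rw [mul_pow, hh, he, one_mul]
  rw [← twistMap_twistedTube C hh he hδ hδ4 u v ht]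
  constructor
  · intro hEq
    have hb : twistedTube h ε δ u (t • (v : 𝔼 2)) ∉ range flatCircle := by
      refine flatTube_not_mem_range hh hδ hδ4 u ?_
      rw [← norm_ne_zero_iff, norm_fibreRot_sphere he, norm_smul, norm_eq_of_mem_sphere v,
        mul_one, Real.norm_of_nonneg ht.le]
      exact ht.ne'
    have := congrArg (twistMap C.σ (-(h * ε))) hEq
    rwa [C.twistMap_neg_twistMap hs ha, C.twistMap_neg_twistMap hs hb] at this
  · intro hEq; rw [hEq]

/-- A point of `T_{hε} (ℝ³ ∖ circle)` is never on the core of `ψ`. [folklore] -/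
theorem twistMap_ne_psiFlat_zero (hh : h ^ 2 = 1) (he : ε ^ 2 = 1) {s : ℝ} (hs : s ^ 2 = 1)
    {a : 𝔼 3} (ha : a ∉ range flatCircle) (v : 𝕊 1) :
    twistMap C.σ s a ≠ psiFlat h ε δ 0 v := by
  intro hEq
  apply C.twistMap_not_mem hs ha
  rw [hEq, psiFlat_zero]
  exact ⟨⟨coreDir h ε v, mem_sphere_zero_iff_norm.2
    (by rw [norm_coreDir hh he, norm_eq_of_mem_sphere v])⟩, rfl⟩

/-- **The flat model covers `ℝ³`**: every point is either the twist of a point off the circle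
or a core point of `ψ`. [folklore] -/
theorem exists_eq_twistMap_or (hh : h ^ 2 = 1) (he : ε ^ 2 = 1) {s : ℝ} (hs : s ^ 2 = 1)
    (p : 𝔼 3) :
    (∃ a, a ∉ range flatCircle ∧ twistMap C.σ s a = p) ∨ ∃ v : 𝕊 1, psiFlat h ε δ 0 v = p := by
  by_cases hp : p ∈ range flatCircle
  · obtain ⟨u, rfl⟩ := hp
    refine Or.inr ⟨⟨coreInv h ε u, mem_sphere_zero_iff_norm.2
      (by rw [norm_coreInv hh he, norm_eq_of_mem_sphere u])⟩, ?_⟩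
    exact (flatCircle_eq_psiFlat_zero hh he u).symm
  · refine Or.inl ⟨twistMap C.σ (-s) p, C.twistMap_not_mem (by rw [neg_sq, hs]) hp, ?_⟩
    exact C.twistMap_twistMap_neg hs hp

end Model


/-! ### Smoothness of the flat model -/

section Smooth

/-- Coordinates of `ℝⁿ` are smooth. [folklore] -/
theorem contDiff_apply_euclidean {n : ℕ} (i : Fin n) : ContDiff ℝ ∞ fun p : 𝔼 n ↦ p i :=
  contDiff_euclidean.1 contDiff_id i

/-- `xy` is smooth. [folklore] -/
theorem contDiff_xy : ContDiff ℝ ∞ xy := by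
  rw [contDiff_euclidean]
  intro i; fin_cases i
  · exact contDiff_apply_euclidean 0
  · exact contDiff_apply_euclidean 1

/-- `mk3` is smooth (jointly). [folklore] -/
theorem contDiff_mk3 : ContDiff ℝ ∞ fun q : (𝔼 2) × ℝ ↦ mk3 q.1 q.2 := by
  rw [contDiff_euclidean]
  intro i; fin_cases i
  · exact (contDiff_apply_euclidean (n := 2) 0).comp contDiff_fst
  · exact (contDiff_apply_euclidean (n := 2) 1).comp contDiff_fst
  · exact contDiff_snd

/-- `mk3` of smooth arguments is smooth. [folklore] -/
theorem ContDiff.mk3 {X : Type*} [NormedAddCommGroup X] [NormedSpace ℝ X] {f : X → 𝔼 2}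
    {g : X → ℝ} (hf : ContDiff ℝ ∞ f) (hg : ContDiff ℝ ∞ g) :
    ContDiff ℝ ∞ fun x ↦ mk3 (f x) (g x) :=
  contDiff_mk3.comp (hf.prodMk hg)

/-- The level function `a` is smooth. [folklore] -/
theorem contDiff_aFun : ContDiff ℝ ∞ aFun := by
  unfold aFun
  exact (((contDiff_apply_euclidean 0).pow 2).add ((contDiff_apply_euclidean 1).pow 2)).sub
    contDiff_const |>.div_const _

/-- The transverse coordinates are smooth. [folklore] -/
theorem contDiff_az : ContDiff ℝ ∞ az := by
  rw [contDiff_euclidean]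
  intro i; fin_cases i
  · exact contDiff_aFun
  · exact contDiff_apply_euclidean 2

/-- `fieldDir h` is smooth (linear). [folklore] -/
theorem contDiff_fieldDir (h : ℝ) : ContDiff ℝ ∞ (fieldDir h) := by
  rw [contDiff_euclidean]
  intro i; fin_cases i
  · exact contDiff_const.mul (contDiff_apply_euclidean 1)
  · exact contDiff_apply_euclidean 0

/-- `coreDir h ε` is smooth (linear). [folklore] -/
theorem contDiff_coreDir (h ε : ℝ) : ContDiff ℝ ∞ (coreDir h ε) := by
  rw [contDiff_euclidean]
  intro i; fin_cases i
  · exact contDiff_const.mul (contDiff_apply_euclidean 1)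
  · exact contDiff_const.mul (contDiff_apply_euclidean 0)

/-- `coreInv h ε` is smooth (linear). [folklore] -/
theorem contDiff_coreInv (h ε : ℝ) : ContDiff ℝ ∞ (coreInv h ε) := by
  rw [contDiff_euclidean]
  intro i; fin_cases i
  · exact contDiff_const.mul (contDiff_apply_euclidean 1)
  · exact contDiff_const.mul (contDiff_apply_euclidean 0)

/-- `fibreRot σ` is smooth as a function of both arguments drawn from smooth maps. [folklore] -/
theorem ContDiff.fibreRot' {X : Type*} [NormedAddCommGroup X] [NormedSpace ℝ X] (σ : ℝ)
    {f g : X → 𝔼 2} (hf : ContDiff ℝ ∞ f) (hg : ContDiff ℝ ∞ g) :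
    ContDiff ℝ ∞ fun x ↦ fibreRot σ (f x) (g x) :=
  (contDiff_fibreRot σ).comp (hf.prodMk hg)

variable {h δ : ℝ}

/-- The tube radius is smooth (`h² = 1`, `0 < δ ≤ 1/4`: the radicand stays `≥ 1/2`). [folklore] -/
theorem contDiff_tubeRadius (hh : h ^ 2 = 1) (hδ : 0 < δ) (hδ4 : δ ≤ 1 / 4) :
    ContDiff ℝ ∞ (tubeRadius h δ) := by
  unfold tubeRadius
  refine ContDiff.sqrt ?_ fun w ↦ ?_
  · exact contDiff_const.add (contDiff_const.mul (contDiff_const.mul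
      ((contDiff_apply_euclidean 1).comp (contDiff_squeeze δ))))
  · have := half_le_radicand hh hδ hδ4 w
    exact (lt_of_lt_of_le (by norm_num) this).ne'

/-- **The flat tube is smooth** (jointly in the core and fibre coordinates). [folklore] -/
theorem contDiff_flatTube (hh : h ^ 2 = 1) (hδ : 0 < δ) (hδ4 : δ ≤ 1 / 4) :
    ContDiff ℝ ∞ fun q : (𝔼 2) × 𝔼 2 ↦ flatTube h δ q.1 q.2 := by
  unfold flatTube
  refine ContDiff.mk3 ?_ ?_
  · exact ((contDiff_tubeRadius hh hδ hδ4).comp contDiff_snd).smul contDiff_fst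
  · exact (contDiff_apply_euclidean 0).comp ((contDiff_squeeze δ).comp contDiff_snd)

/-- The flat tube with substituted arguments, as a composition. [folklore] -/
theorem flatTube_comp_eq {X : Type*} (f g : X → 𝔼 2) :
    (fun x ↦ flatTube h δ (f x) (g x)) =
      (fun q : (𝔼 2) × 𝔼 2 ↦ flatTube h δ q.1 q.2) ∘ fun x ↦ (f x, g x) :=
  rfl

/-- The flat tube of smooth arguments is smooth. [folklore] -/
theorem ContDiff.flatTube' {X : Type*} [NormedAddCommGroup X] [NormedSpace ℝ X] (hh : h ^ 2 = 1)
    (hδ : 0 < δ) (hδ4 : δ ≤ 1 / 4) {f g : X → 𝔼 2} (hf : ContDiff ℝ ∞ f) (hg : ContDiff ℝ ∞ g) :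
    ContDiff ℝ ∞ fun x ↦ flatTube h δ (f x) (g x) := by
  rw [flatTube_comp_eq]
  exact (contDiff_flatTube hh hδ hδ4).comp (hf.prodMk hg)

/-- The twisted flat tube is smooth. [folklore] -/
theorem contDiff_twistedTube (hh : h ^ 2 = 1) (hδ : 0 < δ) (hδ4 : δ ≤ 1 / 4) (ε : ℝ) :
    ContDiff ℝ ∞ fun q : (𝔼 2) × 𝔼 2 ↦ twistedTube h ε δ q.1 q.2 := by
  unfold twistedTube
  exact ContDiff.flatTube' hh hδ hδ4 contDiff_fst (ContDiff.fibreRot' ε contDiff_fst contDiff_snd)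

/-- `ψ` is smooth (jointly). [folklore] -/
theorem contDiff_psiFlat (hh : h ^ 2 = 1) (hδ : 0 < δ) (hδ4 : δ ≤ 1 / 4) (ε : ℝ) :
    ContDiff ℝ ∞ fun q : (𝔼 2) × 𝔼 2 ↦ psiFlat h ε δ q.1 q.2 := by
  unfold psiFlat
  exact ContDiff.flatTube' hh hδ hδ4 ((contDiff_coreDir h ε).comp contDiff_snd)
    (ContDiff.fibreRot' ε contDiff_fst contDiff_snd)

/-- Normalisation is smooth off the origin. [folklore] -/
theorem contDiffAt_inv_norm_smul {v : 𝔼 2} (hv : v ≠ 0) :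
    ContDiffAt ℝ ∞ (fun v : 𝔼 2 ↦ ‖v‖⁻¹ • v) v :=
  ((contDiffAt_norm ℝ hv).inv (norm_ne_zero_iff.2 hv)).smul contDiffAt_id

variable {δ' : ℝ} (C : Cutoff δ')

/-- The twist field of a smooth cut-off is smooth. [folklore] -/
theorem Cutoff.contDiff_field (hσ : ContDiff ℝ ∞ C.σ) : ContDiff ℝ ∞ (field C.σ) := by
  unfold field
  exact ((contDiff_const.sub hσ).smul contDiff_az).add (hσ.smul contDiff_const)

/-- **The normalised twist field is smooth off the flat circle.** [folklore] -/
theorem Cutoff.contDiffAt_bhat (hσ : ContDiff ℝ ∞ C.σ) {p : 𝔼 3} (hp : p ∉ range flatCircle) :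
    ContDiffAt ℝ ∞ (bhat C.σ) p := by
  have hF := C.field_ne_zero (mt (mem_range_flatCircle_iff p).2 hp)
  exact (contDiffAt_inv_norm_smul hF).comp p (C.contDiff_field hσ).contDiffAt

/-- **The twist map is smooth off the flat circle.** [folklore] -/
theorem Cutoff.contDiffAt_twistMap (hσ : ContDiff ℝ ∞ C.σ) (s : ℝ) {p : 𝔼 3}
    (hp : p ∉ range flatCircle) : ContDiffAt ℝ ∞ (twistMap C.σ s) p := by
  unfold twistMap
  have h1 : ContDiffAt ℝ ∞ (fun p ↦ fibreRot s (bhat C.σ p) (xy p)) p :=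
    (contDiff_fibreRot s).contDiffAt.comp p ((C.contDiffAt_bhat hσ hp).prodMk contDiff_xy.contDiffAt)
  exact contDiff_mk3.contDiffAt.comp p (h1.prodMk (contDiff_apply_euclidean 2).contDiffAt)

/-- The twist map is smooth on the complement of the flat circle. [folklore] -/
theorem Cutoff.contDiffOn_twistMap (hσ : ContDiff ℝ ∞ C.σ) (s : ℝ) :
    ContDiffOn ℝ ∞ (twistMap C.σ s) (range flatCircle)ᶜ := fun _ hp ↦
  (C.contDiffAt_twistMap hσ s hp).contDiffWithinAt

/-- The flat circle is a compact, hence closed, subset of `ℝ³`; its complement is open. [folklore] -/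
theorem isOpen_compl_range_flatCircle : IsOpen (range flatCircle)ᶜ := by
  have hc : Continuous flatCircle := by
    unfold flatCircle
    exact (contDiff_mk3.continuous).comp
      ((continuous_subtype_val).prodMk continuous_const)
  exact (isCompact_range hc).isClosed.isOpen_compl

end Smooth


/-! ### Existence of admissible cut-offs inside a neighbourhood of the flat disc -/

section CutoffExistence

/-- The flat closed unit disc `{z = 0, x² + y² ≤ 1}` of `ℝ³`. [folklore] -/
def flatDisc : Set (𝔼 3) := {p | p 2 = 0 ∧ p 0 ^ 2 + p 1 ^ 2 ≤ 1}

/-- The box `N_η = {x² + y² ≤ 1 + η, |z| ≤ η}` around the flat disc. [folklore] -/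
def flatBox (η : ℝ) : Set (𝔼 3) := {p | p 0 ^ 2 + p 1 ^ 2 ≤ 1 + η ∧ |p 2| ≤ η}

/-- The gauge `g = max (x² + y² - 1) |z|` whose sublevel sets are the boxes. [folklore] -/
def boxGauge (p : 𝔼 3) : ℝ := max (p 0 ^ 2 + p 1 ^ 2 - 1) |p 2|

/-- The gauge is continuous. [folklore] -/
theorem continuous_boxGauge : Continuous boxGauge := by
  unfold boxGauge
  have h0 := (contDiff_apply_euclidean (n := 3) 0).continuous
  have h1 := (contDiff_apply_euclidean (n := 3) 1).continuous
  have h2 := (contDiff_apply_euclidean (n := 3) 2).continuous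
  exact (((h0.pow 2).add (h1.pow 2)).sub continuous_const).max h2.abs

/-- The box `N_η` is the sublevel set `{g ≤ η}`. [folklore] -/
theorem mem_flatBox_iff (η : ℝ) (p : 𝔼 3) : p ∈ flatBox η ↔ boxGauge p ≤ η := by
  simp only [flatBox, mem_setOf_eq, boxGauge, max_le_iff]
  constructor
  · rintro ⟨h1, h2⟩; exact ⟨by linarith, h2⟩
  · rintro ⟨h1, h2⟩; exact ⟨by linarith, h2⟩

/-- The sublevel set `{g ≤ 0}` is the flat disc. [folklore] -/
theorem boxGauge_nonpos_iff (p : 𝔼 3) : boxGauge p ≤ 0 ↔ p ∈ flatDisc := by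
  simp only [boxGauge, max_le_iff, abs_nonpos_iff, flatDisc, mem_setOf_eq]
  constructor
  · rintro ⟨h1, h2⟩; exact ⟨h2, by linarith⟩
  · rintro ⟨h1, h2⟩; exact ⟨by linarith, h1⟩

/-- `‖p‖² = x² + y² + z²` on `ℝ³`. [folklore] -/
theorem norm_sq_eq_three (p : 𝔼 3) : ‖p‖ ^ 2 = p 0 ^ 2 + p 1 ^ 2 + p 2 ^ 2 := by
  rw [EuclideanSpace.norm_eq, Real.sq_sqrt (Finset.sum_nonneg fun _ _ ↦ sq_nonneg _),
    Fin.sum_univ_three, Real.norm_eq_abs, Real.norm_eq_abs, Real.norm_eq_abs, sq_abs, sq_abs,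
    sq_abs]

/-- The boxes are compact (closed and bounded). [folklore] -/
theorem isCompact_flatBox {η : ℝ} (hη : 0 ≤ η) : IsCompact (flatBox η) := by
  have hclosed : IsClosed (flatBox η) := by
    have : flatBox η = boxGauge ⁻¹' Iic η := by
      ext p; rw [mem_flatBox_iff]; rfl
    rw [this]
    exact isClosed_Iic.preimage continuous_boxGauge
  refine Metric.isCompact_of_isClosed_isBounded hclosed ?_
  refine (Metric.isBounded_closedBall (x := (0 : 𝔼 3)) (r := 1 + 2 * η + 1)).subset ?_
  intro p hp
  obtain ⟨h1, h2⟩ := hp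
  rw [Metric.mem_closedBall, dist_zero_right]
  have hz : p 2 ^ 2 ≤ η ^ 2 := by
    rw [← sq_abs]; exact pow_le_pow_left₀ (abs_nonneg _) h2 2
  have hn : ‖p‖ ^ 2 ≤ (1 + 2 * η + 1) ^ 2 := by
    rw [norm_sq_eq_three]; nlinarith
  exact abs_le_of_sq_le_sq' hn (by linarith) |>.2.trans_eq (by simp)

/-- **A box around the flat disc inside any neighbourhood of it**: for an open `W ⊇ flatDisc`
there is `0 < η ≤ 1/2` with `N_η ⊆ W` (compactness: the gauge has a positive minimum on
`N_1 ∖ W`). [folklore] -/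
theorem exists_flatBox_subset {W : Set (𝔼 3)} (hW : IsOpen W) (hDW : flatDisc ⊆ W) :
    ∃ η : ℝ, 0 < η ∧ η ≤ 1 / 2 ∧ flatBox η ⊆ W := by
  set K : Set (𝔼 3) := flatBox 1 ∩ Wᶜ with hK
  have hKc : IsCompact K := (isCompact_flatBox zero_le_one).inter_right hW.isClosed_compl
  by_cases hne : K.Nonempty
  · obtain ⟨p₀, hp₀, hmin⟩ := hKc.exists_isMinOn hne continuous_boxGauge.continuousOn
    have hpos : 0 < boxGauge p₀ := by
      by_contra hle
      exact hp₀.2 (hDW ((boxGauge_nonpos_iff p₀).1 (not_lt.1 hle)))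
    refine ⟨min (boxGauge p₀ / 2) (1 / 2), lt_min (half_pos hpos) (by norm_num), min_le_right _ _,
      fun p hp ↦ ?_⟩
    by_contra hpW
    have hp1 : p ∈ flatBox 1 := by
      rw [mem_flatBox_iff] at hp ⊢
      exact hp.trans ((min_le_right _ _).trans (by norm_num))
    have := hmin ⟨hp1, hpW⟩
    rw [mem_flatBox_iff] at hp
    change boxGauge p₀ ≤ boxGauge p at this
    linarith [min_le_left (boxGauge p₀ / 2) (1 / 2)]
  · refine ⟨1 / 2, by norm_num, le_rfl, fun p hp ↦ ?_⟩
    by_contra hpW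
    refine hne ⟨p, ?_, hpW⟩
    rw [mem_flatBox_iff] at hp ⊢
    linarith

/-- The projection `(x, y, z) ↦ (x² + y², z)` to the orbit space of the rotations. [folklore] -/
def orbitProj (p : 𝔼 3) : ℝ × ℝ := (p 0 ^ 2 + p 1 ^ 2, p 2)

/-- The orbit projection is smooth. [folklore] -/
theorem contDiff_orbitProj : ContDiff ℝ ∞ orbitProj :=
  (((contDiff_apply_euclidean 0).pow 2).add ((contDiff_apply_euclidean 1).pow 2)).prodMk
    (contDiff_apply_euclidean 2)

/-- **Existence of admissible cut-offs.** For every open neighbourhood `W` of the flat closed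
unit disc in `ℝ³` there are a thickness `0 < δ ≤ 1/4` and an admissible cut-off of thickness `δ`
which is `C^∞`, with compact support region contained in `W` (a smooth Urysohn function of
`(x² + y², z)`, equal to `0` near the disc and the `δ`-tube and to `1` off a box `N_η ⊆ W`).
[folklore] -/
theorem exists_cutoff {W : Set (𝔼 3)} (hW : IsOpen W) (hDW : flatDisc ⊆ W) :
    ∃ (δ : ℝ) (C : Cutoff δ), 0 < δ ∧ δ ≤ 1 / 4 ∧ ContDiff ℝ ∞ C.σ ∧ IsCompact C.supp ∧
      C.supp ⊆ W := by
  obtain ⟨η, hη, hη2, hbox⟩ := exists_flatBox_subset hW hDW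
  set δ : ℝ := η / 8 with hδ
  have hδpos : 0 < δ := by positivity
  -- the closed set `K₂` (disc and `2δ`-tube in orbit coordinates) and the box `t₂`
  set K₂ : Set (ℝ × ℝ) :=
    {q | q.2 = 0 ∧ -1 ≤ q.1 ∧ q.1 ≤ 1} ∪ {q | ((q.1 - 1) / 2) ^ 2 + q.2 ^ 2 ≤ (2 * δ) ^ 2} with hK₂
  set t₂ : Set (ℝ × ℝ) := {q | q.1 ≤ 1 + η ∧ |q.2| ≤ η} with ht₂
  have hK₂closed : IsClosed K₂ := by
    refine IsClosed.union ?_ ?_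
    · exact (isClosed_eq continuous_snd continuous_const).inter
        ((isClosed_le continuous_const continuous_fst).inter
          (isClosed_le continuous_fst continuous_const))
    · exact isClosed_le ((((continuous_fst.sub continuous_const).div_const _).pow 2).add
        (continuous_snd.pow 2)) continuous_const
  have hK₂int : K₂ ⊆ interior t₂ := by
    have hopen : IsOpen {q : ℝ × ℝ | q.1 < 1 + η ∧ |q.2| < η} :=
      (isOpen_lt continuous_fst continuous_const).inter
        (isOpen_lt continuous_snd.abs continuous_const)
    refine (subset_interior_iff_isOpen.2 hopen).trans' ?_ |>.trans
      (interior_mono fun q hq ↦ ⟨hq.1.le, hq.2.le⟩)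
    rintro ⟨s, z⟩ (⟨hz, -, hs⟩ | hq)
    · simp only [mem_setOf_eq] at hz hs ⊢
      rw [hz, abs_zero]
      exact ⟨by linarith, hη⟩
    · simp only [mem_setOf_eq] at hq ⊢
      have h1 : ((s - 1) / 2) ^ 2 ≤ (2 * δ) ^ 2 := by nlinarith
      have h2 : z ^ 2 ≤ (2 * δ) ^ 2 := by nlinarith
      have h1' := abs_le_of_sq_le_sq' h1 (by positivity)
      have h2' := abs_le_of_sq_le_sq' h2 (by positivity)
      refine ⟨by linarith [h1'.2], ?_⟩
      rw [abs_lt]; constructor <;> linarith [h2'.1, h2'.2]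
  obtain ⟨f, hf1, hf0, hf01⟩ := exists_contMDiffMap_one_nhds_of_subset_interior
    𝓘(ℝ, ℝ × ℝ) hK₂closed hK₂int (n := (⊤ : ℕ∞))
  have hfsmooth : ContDiff ℝ ∞ (f : ℝ × ℝ → ℝ) := contMDiff_iff_contDiff.1 f.contMDiff
  have hfK : ∀ q ∈ K₂, f q = 1 := fun q hq ↦ hf1.self_of_nhdsSet q hq
  -- the cut-off
  refine ⟨δ,
    { σ := fun p ↦ 1 - f (orbitProj p)
      supp := flatBox η
      nonneg := fun p ↦ by linarith [(hf01 (orbitProj p)).2]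
      le_one := fun p ↦ by linarith [(hf01 (orbitProj p)).1]
      rot := fun p q h1 h2 ↦ by simp only [orbitProj, h1, h2]
      supp_rot := fun p q h1 h2 hp ↦ by
        simp only [flatBox, mem_setOf_eq] at hp ⊢; rw [← h1, ← h2]; exact hp
      eq_zero_of_disc := fun p hz hr ↦ ?_
      eq_zero_of_tube := fun p hp ↦ ?_
      eq_one := fun p hp ↦ ?_ }, hδpos, by linarith, ?_, isCompact_flatBox hη.le, hbox⟩
  · -- on the disc
    have : orbitProj p ∈ K₂ := Or.inl ⟨hz, by simp only [orbitProj]; nlinarith, hr⟩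
    simp only [hfK _ this, sub_self]
  · -- on the `δ`-tube
    have hsq : ‖az p‖ ^ 2 = aFun p ^ 2 + p 2 ^ 2 := norm_sq_eq_of_fin_two (az p)
    have : orbitProj p ∈ K₂ := by
      refine Or.inr ?_
      simp only [mem_setOf_eq, orbitProj]
      have h1 : (p 0 ^ 2 + p 1 ^ 2 - 1) / 2 = aFun p := rfl
      rw [h1]
      have h2 : ‖az p‖ ^ 2 < δ ^ 2 := pow_lt_pow_left₀ hp (norm_nonneg _) two_ne_zero
      nlinarith
    simp only [hfK _ this, sub_self]
  · -- off the box
    have : orbitProj p ∉ t₂ := fun h ↦ hp ⟨h.1, h.2⟩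
    simp only [hf0 _ this, sub_zero]
  · -- smoothness
    exact contDiff_const.sub (hfsmooth.comp contDiff_orbitProj)

end CutoffExistence


/-! ### The flat tube as a partial diffeomorphism `S¹ × ℝ² ≅ {‖(a, z)‖ < δ}` -/

section TubeInverse

/-- The norm of `e₀` is `1`. [folklore] -/
theorem norm_e0 : ‖e0‖ = 1 := by
  have : ‖e0‖ ^ 2 = 1 := by rw [norm_sq_eq_of_fin_two]; simp
  nlinarith [norm_nonneg e0]

/-- The unit vector of `v` (junk value `e₀` at the origin). [folklore] -/
def unitVec (v : 𝔼 2) : 𝔼 2 := if v = 0 then e0 else ‖v‖⁻¹ • v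

/-- Off the origin the unit vector is the normalisation. [folklore] -/
theorem unitVec_of_ne {v : 𝔼 2} (hv : v ≠ 0) : unitVec v = ‖v‖⁻¹ • v := if_neg hv

/-- The unit vector has norm `1`. [folklore] -/
theorem norm_unitVec (v : 𝔼 2) : ‖unitVec v‖ = 1 := by
  by_cases hv : v = 0
  · rw [unitVec, if_pos hv, norm_e0]
  · rw [unitVec_of_ne hv, norm_smul, norm_inv, norm_norm, inv_mul_cancel₀ (norm_ne_zero_iff.2 hv)]

/-- Rescaling the unit vector by the norm gives back the vector (also at the origin). [folklore] -/
theorem norm_smul_unitVec (v : 𝔼 2) : ‖v‖ • unitVec v = v := by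
  by_cases hv : v = 0
  · rw [hv, norm_zero, zero_smul]
  · rw [unitVec_of_ne hv, smul_smul, mul_inv_cancel₀ (norm_ne_zero_iff.2 hv), one_smul]

/-- The unit vector of `v`, as a point of the circle. [folklore] -/
def unitS (v : 𝔼 2) : 𝕊 1 := ⟨unitVec v, mem_sphere_zero_iff_norm.2 (norm_unitVec v)⟩

/-- The unit vector as a point of the circle, coerced back. [folklore] -/
@[simp] theorem coe_unitS (v : 𝔼 2) : (unitS v : 𝔼 2) = unitVec v := rfl

/-- The unit vector of a positive multiple of a point of the circle is that point. [folklore] -/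
theorem unitS_smul {r : ℝ} (hr : 0 < r) (u : 𝕊 1) : unitS (r • (u : 𝔼 2)) = u := by
  apply Subtype.ext
  have hne : r • (u : 𝔼 2) ≠ 0 := smul_ne_zero hr.ne' (ne_zero_of_mem_unit_sphere u)
  rw [coe_unitS, unitVec_of_ne hne, norm_smul, Real.norm_of_nonneg hr.le, norm_eq_of_mem_sphere u,
    mul_one, smul_smul, inv_mul_cancel₀ hr.ne', one_smul]

/-- The unit vector map is smooth off the origin. [folklore] -/
theorem contDiffOn_unitVec : ContDiffOn ℝ ∞ unitVec {v | v ≠ 0} := fun _ hv ↦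
  ((contDiffAt_inv_norm_smul hv).congr_of_eventuallyEq
    (Filter.eventually_of_mem (isOpen_ne.mem_nhds hv) fun _ hw ↦ unitVec_of_ne hw)).contDiffWithinAt

/-- **A map into a sphere is smooth on an open set if it is smooth there as a vector-valued map**
(local form of Mathlib's `ContMDiff.codRestrict_sphere`, by restriction to the open submanifold;
pattern of the tree's `RotationBody.lean`). [folklore] -/
theorem contMDiffOn_codRestrict_sphere_of_isOpen {F H : Type*} [NormedAddCommGroup F]
    [NormedSpace ℝ F] [TopologicalSpace H] {I : ModelWithCorners ℝ F H} {N : Type*}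
    [TopologicalSpace N] [ChartedSpace H N] [IsManifold I ∞ N] {E : Type*} [NormedAddCommGroup E]
    [InnerProductSpace ℝ E] {k : ℕ} [Fact (Module.finrank ℝ E = k + 1)] {f : N → E} {O : Set N}
    (hO : IsOpen O) (hf : ContMDiffOn I 𝓘(ℝ, E) ∞ f O)
    (hf' : ∀ x, f x ∈ Metric.sphere (0 : E) 1) :
    ContMDiffOn I (𝓡 k) ∞ (Set.codRestrict f _ hf') O := by
  intro x hx
  set U : TopologicalSpace.Opens N := ⟨O, hO⟩
  have hg : ContMDiff I 𝓘(ℝ, E) ∞ (f ∘ (Subtype.val : U → N)) :=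
    hf.comp_contMDiff contMDiff_subtype_val fun y ↦ y.2
  have hg' : ContMDiff I (𝓡 k) ∞ (Set.codRestrict (f ∘ (Subtype.val : U → N)) _ fun y ↦ hf' y.1) :=
    hg.codRestrict_sphere _
  have h2 : ContMDiffAt I (𝓡 k) ∞ (fun y : U ↦ Set.codRestrict f _ hf' y.1) ⟨x, hx⟩ := hg' ⟨x, hx⟩
  exact (contMDiffAt_subtype_iff.1 h2).contMDiffWithinAt

attribute [local instance] fact_finrank_euclideanSpace_two

/-- The circle-valued unit vector map is smooth off the origin. [folklore] -/
theorem contMDiffOn_unitS : ContMDiffOn 𝓘(ℝ, 𝔼 2) (𝓡 1) ∞ unitS {v | v ≠ 0} :=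
  contMDiffOn_codRestrict_sphere_of_isOpen isOpen_ne contDiffOn_unitVec.contMDiffOn
    fun v ↦ mem_sphere_zero_iff_norm.2 (norm_unitVec v)

/-- The inverse `(q₁, h q₀)` of `fieldDir h` (`h² = 1`). [folklore] -/
def fieldInv (h : ℝ) (q : 𝔼 2) : 𝔼 2 := !₂[q 1, h * q 0]

/-- First coordinate of `fieldInv`. [folklore] -/
@[simp] theorem fieldInv_apply_zero (h : ℝ) (q : 𝔼 2) : fieldInv h q 0 = q 1 := rfl
/-- Second coordinate of `fieldInv`. [folklore] -/
@[simp] theorem fieldInv_apply_one (h : ℝ) (q : 𝔼 2) : fieldInv h q 1 = h * q 0 := rfl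

/-- `fieldInv h ∘ fieldDir h = id` for `h² = 1`. [folklore] -/
theorem fieldInv_fieldDir {h : ℝ} (hh : h ^ 2 = 1) (w : 𝔼 2) : fieldInv h (fieldDir h w) = w := by
  ext i; fin_cases i <;> simp
  linear_combination (w 1) * hh

/-- `fieldDir h ∘ fieldInv h = id` for `h² = 1`. [folklore] -/
theorem fieldDir_fieldInv {h : ℝ} (hh : h ^ 2 = 1) (q : 𝔼 2) : fieldDir h (fieldInv h q) = q := by
  ext i; fin_cases i <;> simp
  linear_combination (q 0) * hh

/-- `‖fieldInv h q‖ = ‖q‖` for `h² = 1`. [folklore] -/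
theorem norm_fieldInv {h : ℝ} (hh : h ^ 2 = 1) (q : 𝔼 2) : ‖fieldInv h q‖ = ‖q‖ := by
  conv_rhs => rw [← fieldDir_fieldInv hh q]
  rw [norm_fieldDir hh]

/-- `fieldInv h` is smooth (linear). [folklore] -/
theorem contDiff_fieldInv (h : ℝ) : ContDiff ℝ ∞ (fieldInv h) := by
  rw [contDiff_euclidean]
  intro i; fin_cases i
  · exact contDiff_apply_euclidean 1
  · exact contDiff_const.mul (contDiff_apply_euclidean 0)

/-- **The inverse of the squeeze map** on the open disc of radius `δ`:
`q ↦ q / √(δ² - ‖q‖²)`. [folklore] -/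
def unsqueeze (δ : ℝ) (q : 𝔼 2) : 𝔼 2 := (Real.sqrt (δ ^ 2 - ‖q‖ ^ 2))⁻¹ • q

/-- `δ² - ‖σ_δ w‖² = (δ ρ(w))²`. [folklore] -/
theorem sq_sub_norm_squeeze_sq (δ : ℝ) (w : 𝔼 2) :
    δ ^ 2 - ‖squeeze δ w‖ ^ 2 = (δ * squeezeFactor w) ^ 2 := by
  have h1 : ‖squeeze δ w‖ ^ 2 = (δ * squeezeFactor w * ‖w‖) ^ 2 := by
    rw [squeeze_def, norm_smul, mul_pow, mul_pow, Real.norm_eq_abs, sq_abs, mul_pow]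
  rw [h1]
  have h2 := squeezeFactor_sq_mul w
  linear_combination (-δ ^ 2) * h2

/-- **`unsqueeze ∘ squeeze = id`** (`0 < δ`). [folklore] -/
theorem unsqueeze_squeeze {δ : ℝ} (hδ : 0 < δ) (w : 𝔼 2) : unsqueeze δ (squeeze δ w) = w := by
  have hpos : 0 < δ * squeezeFactor w := mul_pos hδ (squeezeFactor_pos w)
  rw [unsqueeze, sq_sub_norm_squeeze_sq, Real.sqrt_sq hpos.le, squeeze_def, smul_smul,
    inv_mul_cancel₀ hpos.ne', one_smul]

/-- **`squeeze ∘ unsqueeze = id` on the open disc of radius `δ`** (`0 < δ`). [folklore] -/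
theorem squeeze_unsqueeze {δ : ℝ} (hδ : 0 < δ) {q : 𝔼 2} (hq : ‖q‖ < δ) :
    squeeze δ (unsqueeze δ q) = q := by
  set s : ℝ := Real.sqrt (δ ^ 2 - ‖q‖ ^ 2) with hs
  have hs2 : 0 < δ ^ 2 - ‖q‖ ^ 2 := by nlinarith [norm_nonneg q]
  have hspos : 0 < s := Real.sqrt_pos.2 hs2
  have hssq : s ^ 2 = δ ^ 2 - ‖q‖ ^ 2 := Real.sq_sqrt hs2.le
  -- `1 + ‖q / s‖² = δ² / s²`
  have hw : 1 + ‖s⁻¹ • q‖ ^ 2 = (δ / s) ^ 2 := by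
    rw [norm_smul, norm_inv, Real.norm_of_nonneg hspos.le, mul_pow, div_pow, inv_pow]
    field_simp
    linarith
  have hρ : squeezeFactor (s⁻¹ • q) = s / δ := by
    rw [squeezeFactor_def, hw, Real.sqrt_sq (div_pos hδ hspos).le, inv_div]
  rw [unsqueeze, ← hs, squeeze_def, hρ, smul_smul, mul_div_cancel₀ _ hδ.ne',
    mul_inv_cancel₀ hspos.ne', one_smul]

/-- The unsqueeze map is smooth on the open disc of radius `δ`. [folklore] -/
theorem contDiffOn_unsqueeze (δ : ℝ) : ContDiffOn ℝ ∞ (unsqueeze δ) (Metric.ball 0 δ) := by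
  intro q hq
  rw [Metric.mem_ball, dist_zero_right] at hq
  have hs2 : 0 < δ ^ 2 - ‖q‖ ^ 2 := by nlinarith [norm_nonneg q]
  have h1 : ContDiffAt ℝ ∞ (fun q : 𝔼 2 ↦ δ ^ 2 - ‖q‖ ^ 2) q :=
    contDiffAt_const.sub (contDiffAt_id.norm_sq ℝ)
  have h2 : ContDiffAt ℝ ∞ (fun q : 𝔼 2 ↦ Real.sqrt (δ ^ 2 - ‖q‖ ^ 2)) q := h1.sqrt hs2.ne'
  exact ((h2.inv (Real.sqrt_pos.2 hs2).ne').smul contDiffAt_id).contDiffWithinAt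

/-- Local notation: the model with corners of `S¹ × ℝ²`. -/
local notation "𝓘₁₂" => (ModelWithCorners.prod (𝓡 1) 𝓘(ℝ, EuclideanSpace ℝ (Fin 2)))

variable (h δ : ℝ)

/-- The flat tube as a map `S¹ × ℝ² → ℝ³`. [folklore] -/
def flatTubeS (q : (𝕊 1) × 𝔼 2) : 𝔼 3 := flatTube h δ q.1 q.2

/-- The flat tube map on points. [folklore] -/
theorem flatTubeS_apply (q : (𝕊 1) × 𝔼 2) : flatTubeS h δ q = flatTube h δ q.1 q.2 := rfl

/-- The inverse of the flat tube: unit vector of the horizontal part, unsqueezed transverse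
coordinates. [folklore] -/
def flatTubeInv (p : 𝔼 3) : (𝕊 1) × 𝔼 2 := (unitS (xy p), unsqueeze δ (fieldInv h (az p)))

variable {h δ}

/-- `x² + y² = 1 + 2 a`. [folklore] -/
theorem norm_xy_sq (p : 𝔼 3) : ‖xy p‖ ^ 2 = 1 + 2 * aFun p := by
  rw [← sq_add_sq_eq_norm_xy_sq, aFun]; ring

/-- The flat tube map as a composition through `ℝ² × ℝ²`. [folklore] -/
theorem flatTubeS_eq_comp : flatTubeS h δ =
    (fun q : (𝔼 2) × 𝔼 2 ↦ flatTube h δ q.1 q.2) ∘ fun q : (𝕊 1) × 𝔼 2 ↦ ((q.1 : 𝔼 2), q.2) :=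
  rfl

/-- The flat tube map is smooth. [folklore] -/
theorem contMDiff_flatTubeS (hh : h ^ 2 = 1) (hδ : 0 < δ) (hδ4 : δ ≤ 1 / 4) :
    ContMDiff 𝓘₁₂ 𝓘(ℝ, 𝔼 3) ∞ (flatTubeS h δ) := by
  have h1 : ContMDiff 𝓘₁₂ 𝓘(ℝ, (𝔼 2) × 𝔼 2) ∞ fun q : (𝕊 1) × 𝔼 2 ↦ ((q.1 : 𝔼 2), q.2) :=
    (contMDiff_coe_sphere.comp contMDiff_fst).prodMk_space contMDiff_snd
  rw [flatTubeS_eq_comp]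
  exact (contDiff_flatTube hh hδ hδ4).contMDiff.comp h1

/-- **`flatTubeInv ∘ flatTubeS = id`.** [folklore] -/
theorem flatTubeInv_flatTubeS (hh : h ^ 2 = 1) (hδ : 0 < δ) (hδ4 : δ ≤ 1 / 4)
    (q : (𝕊 1) × 𝔼 2) : flatTubeInv h δ (flatTubeS h δ q) = q := by
  obtain ⟨u, w⟩ := q
  rw [flatTubeInv, flatTubeS_apply, xy_flatTube, unitS_smul (tubeRadius_pos hh hδ hδ4 w),
    az_flatTube hh hδ hδ4, fieldInv_fieldDir hh, unsqueeze_squeeze hδ]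

/-- **`flatTubeS ∘ flatTubeInv = id` on the tube `{‖(a, z)‖ < δ}`.** [folklore] -/
theorem flatTubeS_flatTubeInv (hh : h ^ 2 = 1) (hδ : 0 < δ) (hδ4 : δ ≤ 1 / 4) {p : 𝔼 3}
    (hp : ‖az p‖ < δ) : flatTubeS h δ (flatTubeInv h δ p) = p := by
  have hq : ‖fieldInv h (az p)‖ < δ := by rwa [norm_fieldInv hh]
  have hsq : squeeze δ (unsqueeze δ (fieldInv h (az p))) = fieldInv h (az p) :=
    squeeze_unsqueeze hδ hq
  have hR : tubeRadius h δ (unsqueeze δ (fieldInv h (az p))) = ‖xy p‖ := by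
    have key : tubeRadius h δ (unsqueeze δ (fieldInv h (az p))) ^ 2 = ‖xy p‖ ^ 2 := by
      rw [tubeRadius_sq hh hδ hδ4, hsq, fieldInv_apply_one, az_apply_zero, norm_xy_sq]
      linear_combination (2 * aFun p) * hh
    exact (pow_left_inj₀ (tubeRadius_pos hh hδ hδ4 _).le (norm_nonneg _) two_ne_zero).1 key
  rw [flatTubeInv, flatTubeS_apply, flatTube, hR, coe_unitS, norm_smul_unitVec, hsq,
    fieldInv_apply_zero, az_apply_one, mk3_xy]

/-- Points of the tube `{‖(a, z)‖ < δ}` (`δ ≤ 1/4`) have nonzero horizontal part. [folklore] -/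
theorem xy_ne_zero_of_norm_az_lt (hδ4 : δ ≤ 1 / 4) {p : 𝔼 3} (hp : ‖az p‖ < δ) : xy p ≠ 0 := by
  intro h0
  have h1 := abs_apply_le_norm_two (az p) 0
  rw [az_apply_zero] at h1
  have h2 : ‖xy p‖ ^ 2 = 0 := by rw [h0, norm_zero]; ring
  rw [norm_xy_sq] at h2
  have h3 := (abs_le.1 (h1.trans hp.le)).1
  linarith

/-- **The flat tube as a partial diffeomorphism** of `S¹ × ℝ²` onto the open tube
`{‖(a, z)‖ < δ}` of `ℝ³` (`h² = 1`, `0 < δ ≤ 1/4`), with the explicit smooth inverse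
`flatTubeInv`. [folklore] -/
def flatTubePD (hh : h ^ 2 = 1) (hδ : 0 < δ) (hδ4 : δ ≤ 1 / 4) :
    PartialDiffeomorph 𝓘₁₂ 𝓘(ℝ, 𝔼 3) ((𝕊 1) × 𝔼 2) (𝔼 3) ∞ where
  toFun := flatTubeS h δ
  invFun := flatTubeInv h δ
  source := univ
  target := {p | ‖az p‖ < δ}
  map_source' q _ := by
    change ‖az (flatTube h δ q.1 q.2)‖ < δ
    rw [norm_az_flatTube hh hδ hδ4]
    exact norm_squeeze_lt hδ _
  map_target' _ _ := mem_univ _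
  left_inv' q _ := flatTubeInv_flatTubeS hh hδ hδ4 q
  right_inv' _ hp := flatTubeS_flatTubeInv hh hδ hδ4 hp
  open_source := isOpen_univ
  open_target := isOpen_lt (contDiff_az.continuous.norm) continuous_const
  contMDiffOn_toFun := (contMDiff_flatTubeS hh hδ hδ4).contMDiffOn
  contMDiffOn_invFun := by
    refine ContMDiffOn.prodMk ?_ ?_
    · exact contMDiffOn_unitS.comp contDiff_xy.contMDiff.contMDiffOn
        fun p hp ↦ xy_ne_zero_of_norm_az_lt hδ4 hp
    · refine ((contDiffOn_unsqueeze δ).comp ((contDiff_fieldInv h).comp contDiff_az).contDiffOn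
        fun p hp ↦ ?_).contMDiffOn
      rw [Metric.mem_ball, dist_zero_right, comp_apply, norm_fieldInv hh]
      exact hp

/-- **The flat tube map is a local diffeomorphism** at every point of `S¹ × ℝ²`. [folklore] -/
theorem isLocalDiffeomorph_flatTubeS (hh : h ^ 2 = 1) (hδ : 0 < δ) (hδ4 : δ ≤ 1 / 4) :
    IsLocalDiffeomorph 𝓘₁₂ 𝓘(ℝ, 𝔼 3) ∞ (flatTubeS h δ) := fun q ↦
  ⟨flatTubePD hh hδ hδ4, mem_univ q, fun _ _ ↦ rfl⟩

/-- The flat tube map is injective. [folklore] -/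
theorem flatTubeS_injective (hh : h ^ 2 = 1) (hδ : 0 < δ) (hδ4 : δ ≤ 1 / 4) :
    Injective (flatTubeS h δ) :=
  (LeftInverse.injective fun q ↦ flatTubeInv_flatTubeS hh hδ hδ4 q)

/-- The image of the flat tube map is the open tube `{‖(a, z)‖ < δ}`. [folklore] -/
theorem range_flatTubeS (hh : h ^ 2 = 1) (hδ : 0 < δ) (hδ4 : δ ≤ 1 / 4) :
    range (flatTubeS h δ) = {p | ‖az p‖ < δ} := by
  ext p
  constructor
  · rintro ⟨q, rfl⟩
    exact (flatTubePD hh hδ hδ4).map_source (mem_univ q)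
  · intro hp
    exact ⟨flatTubeInv h δ p, flatTubeS_flatTubeInv hh hδ hδ4 hp⟩

end TubeInverse


/-! ### The new solid torus as a local diffeomorphism `D̊² × S¹ → ℝ³` -/

section SolidTorusTwist

variable {h ε : ℝ}

/-- The reflection `(w₀, w₁) ↦ (w₀, ε w₁)` (`ε = ±1`). [folklore] -/
def reflE (ε : ℝ) (w : 𝔼 2) : 𝔼 2 := !₂[w 0, ε * w 1]

/-- First coordinate of `reflE`. [folklore] -/
@[simp] theorem reflE_apply_zero (ε : ℝ) (w : 𝔼 2) : reflE ε w 0 = w 0 := rfl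
/-- Second coordinate of `reflE`. [folklore] -/
@[simp] theorem reflE_apply_one (ε : ℝ) (w : 𝔼 2) : reflE ε w 1 = ε * w 1 := rfl

/-- `‖reflE ε w‖ = ‖w‖` for `ε² = 1`. [folklore] -/
theorem norm_reflE (he : ε ^ 2 = 1) (w : 𝔼 2) : ‖reflE ε w‖ = ‖w‖ := by
  have h1 : ‖reflE ε w‖ ^ 2 = ‖w‖ ^ 2 := by
    rw [norm_sq_eq_of_fin_two, norm_sq_eq_of_fin_two, reflE_apply_zero, reflE_apply_one]
    linear_combination (w 1 ^ 2) * he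
  nlinarith [norm_nonneg (reflE ε w), norm_nonneg w]

/-- **Solving `w = fibreRot ε p v` for `p`** (unit `v`, `ε² = 1`):
`p = reflE ε (fibreRot (-1) v w)`. [folklore] -/
theorem reflE_fibreRot_neg_one_fibreRot (he : ε ^ 2 = 1) (v : 𝕊 1) (p : 𝔼 2) :
    reflE ε (fibreRot (-1) (v : 𝔼 2) (fibreRot ε p (v : 𝔼 2))) = p := by
  have hv := sphere_sq v
  ext i; fin_cases i <;> simp
  · linear_combination (p 0) * hv
  · linear_combination (ε ^ 2 * p 1) * hv + (p 1) * he

/-- Conversely `fibreRot ε (reflE ε (fibreRot (-1) v w)) v = w` (unit `v`, `ε² = 1`). [folklore] -/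
theorem fibreRot_reflE_fibreRot_neg_one (he : ε ^ 2 = 1) (v : 𝕊 1) (w : 𝔼 2) :
    fibreRot ε (reflE ε (fibreRot (-1) (v : 𝔼 2) w)) (v : 𝔼 2) = w := by
  have hv := sphere_sq v
  ext i; fin_cases i <;> simp
  · linear_combination (w 0) * hv + ((v : 𝔼 2) 1 * ((v : 𝔼 2) 1 * w 0) - (v : 𝔼 2) 1 * ((v : 𝔼 2) 0 * w 1)) * he
  · linear_combination (w 1) * hv + (-(v : 𝔼 2) 0 * ((v : 𝔼 2) 1 * w 0) + (v : 𝔼 2) 0 * ((v : 𝔼 2) 0 * w 1)) * he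

variable (h ε)

/-- The core direction as a self-map of the circle (`h² = ε² = 1`). [folklore] -/
def coreDirS (hh : h ^ 2 = 1) (he : ε ^ 2 = 1) (v : 𝕊 1) : 𝕊 1 :=
  ⟨coreDir h ε v, mem_sphere_zero_iff_norm.2 (by rw [norm_coreDir hh he, norm_eq_of_mem_sphere v])⟩

/-- Its inverse. [folklore] -/
def coreInvS (hh : h ^ 2 = 1) (he : ε ^ 2 = 1) (u : 𝕊 1) : 𝕊 1 :=
  ⟨coreInv h ε u, mem_sphere_zero_iff_norm.2 (by rw [norm_coreInv hh he, norm_eq_of_mem_sphere u])⟩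

variable {h ε}

/-- `coreDirS` coerced back to the plane. [folklore] -/
@[simp] theorem coe_coreDirS (hh : h ^ 2 = 1) (he : ε ^ 2 = 1) (v : 𝕊 1) :
    (coreDirS h ε hh he v : 𝔼 2) = coreDir h ε v := rfl

/-- `coreInvS` coerced back to the plane. [folklore] -/
@[simp] theorem coe_coreInvS (hh : h ^ 2 = 1) (he : ε ^ 2 = 1) (u : 𝕊 1) :
    (coreInvS h ε hh he u : 𝔼 2) = coreInv h ε u := rfl

/-- `coreInvS ∘ coreDirS = id`. [folklore] -/
theorem coreInvS_coreDirS (hh : h ^ 2 = 1) (he : ε ^ 2 = 1) (v : 𝕊 1) :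
    coreInvS h ε hh he (coreDirS h ε hh he v) = v :=
  Subtype.ext (coreInv_coreDir hh he _)

/-- `coreDirS ∘ coreInvS = id`. [folklore] -/
theorem coreDirS_coreInvS (hh : h ^ 2 = 1) (he : ε ^ 2 = 1) (u : 𝕊 1) :
    coreDirS h ε hh he (coreInvS h ε hh he u) = u :=
  Subtype.ext (coreDir_coreInv hh he _)

/-- `coreDirS` is smooth. [folklore] -/
theorem contMDiff_coreDirS (hh : h ^ 2 = 1) (he : ε ^ 2 = 1) :
    ContMDiff (𝓡 1) (𝓡 1) ∞ (coreDirS h ε hh he) :=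
  ((contDiff_coreDir h ε).contMDiff.comp contMDiff_coe_sphere).codRestrict_sphere _

/-- `coreInvS` is smooth. [folklore] -/
theorem contMDiff_coreInvS (hh : h ^ 2 = 1) (he : ε ^ 2 = 1) :
    ContMDiff (𝓡 1) (𝓡 1) ∞ (coreInvS h ε hh he) :=
  ((contDiff_coreInv h ε).contMDiff.comp contMDiff_coe_sphere).codRestrict_sphere _

/-- Local notation: the model with corners of `ℝ² × S¹`. -/
local notation "𝓘₂₁" => (ModelWithCorners.prod 𝓘(ℝ, EuclideanSpace ℝ (Fin 2)) (𝓡 1))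

/-- `fibreRot σ` of two smooth maps into `ℝ²` is smooth (manifold version). [folklore] -/
theorem ContMDiff.fibreRot'' {X : Type*} [TopologicalSpace X] {HX : Type*} [TopologicalSpace HX]
    {EX : Type*} [NormedAddCommGroup EX] [NormedSpace ℝ EX] {IX : ModelWithCorners ℝ EX HX}
    [ChartedSpace HX X] (σ : ℝ) {f g : X → 𝔼 2} (hf : ContMDiff IX 𝓘(ℝ, 𝔼 2) ∞ f)
    (hg : ContMDiff IX 𝓘(ℝ, 𝔼 2) ∞ g) : ContMDiff IX 𝓘(ℝ, 𝔼 2) ∞ fun x ↦ fibreRot σ (f x) (g x) :=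
  (contDiff_fibreRot σ).contMDiff.comp (hf.prodMk_space hg)

/-- **The twist of the solid torus** `(p, v) ↦ (fibreRot ε p v, coreDirS v)`: the change of
coordinates from the new solid torus to the fibre/core coordinates of the flat tube. [folklore] -/
def torusTwistFun (hh : h ^ 2 = 1) (he : ε ^ 2 = 1) (b : solidTorus) : (𝔼 2) × (𝕊 1) :=
  (fibreRot ε (b : (𝔼 2) × (𝕊 1)).1 (b : (𝔼 2) × (𝕊 1)).2, coreDirS h ε hh he (b : (𝔼 2) × (𝕊 1)).2)

/-- The candidate inverse of the twist of the solid torus on `ℝ² × S¹` (valid on `{‖w‖ < 1}`). [folklore] -/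
def torusTwistInvFun (hh : h ^ 2 = 1) (he : ε ^ 2 = 1) (q : (𝔼 2) × (𝕊 1)) : (𝔼 2) × (𝕊 1) :=
  (reflE ε (fibreRot (-1) (coreInv h ε q.2) q.1), coreInvS h ε hh he q.2)

/-- The first component of the candidate inverse has the norm of `w`. [folklore] -/
theorem norm_torusTwistInvFun_fst (hh : h ^ 2 = 1) (he : ε ^ 2 = 1) (q : (𝔼 2) × (𝕊 1)) :
    ‖(torusTwistInvFun hh he q).1‖ = ‖q.1‖ := by
  rw [torusTwistInvFun, norm_reflE he]
  have := norm_fibreRot_sphere (σ := -1) (by norm_num) (coreInvS h ε hh he q.2) q.1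
  rwa [coe_coreInvS] at this

open Classical in
/-- The inverse of the twist of the solid torus (junk off `{‖w‖ < 1}`). [folklore] -/
def torusTwistInv (hh : h ^ 2 = 1) (he : ε ^ 2 = 1) (q : (𝔼 2) × (𝕊 1)) : solidTorus :=
  if hq : ‖q.1‖ < 1 then
    ⟨torusTwistInvFun hh he q, by rw [mem_solidTorus_iff, norm_torusTwistInvFun_fst]; exact hq⟩
  else ⟨(0, q.2), by simp⟩

/-- On `{‖w‖ < 1}` the inverse is the candidate inverse. [folklore] -/
theorem coe_torusTwistInv (hh : h ^ 2 = 1) (he : ε ^ 2 = 1) {q : (𝔼 2) × (𝕊 1)}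
    (hq : ‖q.1‖ < 1) : (torusTwistInv hh he q : (𝔼 2) × (𝕊 1)) = torusTwistInvFun hh he q := by
  rw [torusTwistInv, dif_pos hq]

/-- The twist of the solid torus is smooth. [folklore] -/
theorem contMDiff_torusTwistFun (hh : h ^ 2 = 1) (he : ε ^ 2 = 1) :
    ContMDiff 𝓘₂₁ 𝓘₂₁ ∞ (torusTwistFun hh he) := by
  have h1 : ContMDiff 𝓘₂₁ 𝓘(ℝ, 𝔼 2) ∞ fun b : solidTorus ↦ (b : (𝔼 2) × (𝕊 1)).1 :=
    contMDiff_fst.comp contMDiff_subtype_val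
  have h2 : ContMDiff 𝓘₂₁ (𝓡 1) ∞ fun b : solidTorus ↦ (b : (𝔼 2) × (𝕊 1)).2 :=
    contMDiff_snd.comp contMDiff_subtype_val
  exact (ContMDiff.fibreRot'' ε h1 (contMDiff_coe_sphere.comp h2)).prodMk
    ((contMDiff_coreDirS hh he).comp h2)

/-- The candidate inverse is smooth. [folklore] -/
theorem contMDiff_torusTwistInvFun (hh : h ^ 2 = 1) (he : ε ^ 2 = 1) :
    ContMDiff 𝓘₂₁ 𝓘₂₁ ∞ (torusTwistInvFun hh he) := by
  have h2 : ContMDiff 𝓘₂₁ 𝓘(ℝ, 𝔼 2) ∞ fun q : (𝔼 2) × (𝕊 1) ↦ coreInv h ε q.2 :=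
    (contDiff_coreInv h ε).contMDiff.comp (contMDiff_coe_sphere.comp contMDiff_snd)
  have h3 : ContMDiff 𝓘₂₁ 𝓘(ℝ, 𝔼 2) ∞ fun q : (𝔼 2) × (𝕊 1) ↦
      fibreRot (-1) (coreInv h ε q.2) q.1 := ContMDiff.fibreRot'' (-1) h2 contMDiff_fst
  have hrefl : ContDiff ℝ ∞ (reflE ε) := by
    rw [contDiff_euclidean]
    intro i; fin_cases i
    · exact contDiff_apply_euclidean 0
    · exact contDiff_const.mul (contDiff_apply_euclidean 1)
  exact (hrefl.contMDiff.comp h3).prodMk ((contMDiff_coreInvS hh he).comp contMDiff_snd)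

/-- **The twist of the solid torus as a partial diffeomorphism** `D̊² × S¹ ≅ {‖w‖ < 1} ⊆ ℝ² × S¹`. [folklore] -/
def torusTwistPD (hh : h ^ 2 = 1) (he : ε ^ 2 = 1) :
    PartialDiffeomorph 𝓘₂₁ 𝓘₂₁ solidTorus ((𝔼 2) × (𝕊 1)) ∞ where
  toFun := torusTwistFun hh he
  invFun := torusTwistInv hh he
  source := univ
  target := {q | ‖q.1‖ < 1}
  map_source' b _ := by
    change ‖fibreRot ε (b : (𝔼 2) × (𝕊 1)).1 (b : (𝔼 2) × (𝕊 1)).2‖ < 1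
    have hb := (mem_solidTorus_iff _).1 b.2
    have hn : ‖fibreRot ε (b : (𝔼 2) × (𝕊 1)).1 ((b : (𝔼 2) × (𝕊 1)).2 : 𝔼 2)‖ =
        ‖(b : (𝔼 2) × (𝕊 1)).1‖ := by
      rw [norm_fibreRot he, norm_eq_of_mem_sphere, mul_one]
    rwa [hn]
  map_target' _ _ := mem_univ _
  left_inv' b _ := by
    have hb := (mem_solidTorus_iff _).1 b.2
    have hlt : ‖(torusTwistFun hh he b).1‖ < 1 := by
      change ‖fibreRot ε (b : (𝔼 2) × (𝕊 1)).1 (b : (𝔼 2) × (𝕊 1)).2‖ < 1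
      rw [norm_fibreRot he, norm_eq_of_mem_sphere, mul_one]; exact hb
    apply Subtype.ext
    rw [coe_torusTwistInv hh he hlt, torusTwistInvFun]
    change (reflE ε (fibreRot (-1) (coreInv h ε (coreDirS h ε hh he (b : (𝔼 2) × (𝕊 1)).2))
      (fibreRot ε (b : (𝔼 2) × (𝕊 1)).1 (b : (𝔼 2) × (𝕊 1)).2)),
      coreInvS h ε hh he (coreDirS h ε hh he (b : (𝔼 2) × (𝕊 1)).2)) = (b : (𝔼 2) × (𝕊 1))
    rw [coreInvS_coreDirS, coe_coreDirS, coreInv_coreDir hh he, reflE_fibreRot_neg_one_fibreRot he]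
  right_inv' q hq := by
    have hval : (torusTwistInv hh he q : (𝔼 2) × (𝕊 1)) = torusTwistInvFun hh he q :=
      coe_torusTwistInv hh he hq
    rw [torusTwistFun, hval, torusTwistInvFun]
    change (fibreRot ε (reflE ε (fibreRot (-1) (coreInv h ε q.2) q.1))
      (coreInvS h ε hh he q.2 : 𝔼 2), coreDirS h ε hh he (coreInvS h ε hh he q.2)) = q
    rw [coreDirS_coreInvS, coe_coreInvS]
    have := fibreRot_reflE_fibreRot_neg_one he (coreInvS h ε hh he q.2) q.1
    rw [coe_coreInvS] at this
    rw [this]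
  open_source := isOpen_univ
  open_target := isOpen_lt (continuous_fst.norm) continuous_const
  contMDiffOn_toFun := (contMDiff_torusTwistFun hh he).contMDiffOn
  contMDiffOn_invFun := by
    intro q hq
    rw [← ContMDiffWithinAt.subtypeVal_comp_iff]
    refine ((contMDiff_torusTwistInvFun hh he) q).contMDiffWithinAt.congr (fun q' hq' ↦ ?_) ?_
    · exact coe_torusTwistInv hh he hq'
    · exact coe_torusTwistInv hh he hq

/-- The twist of the solid torus is a local diffeomorphism at every point. [folklore] -/
theorem isLocalDiffeomorph_torusTwistFun (hh : h ^ 2 = 1) (he : ε ^ 2 = 1) :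
    IsLocalDiffeomorph 𝓘₂₁ 𝓘₂₁ ∞ (torusTwistFun hh he) := fun b ↦
  ⟨torusTwistPD hh he, mem_univ b, fun _ _ ↦ rfl⟩

variable (δ : ℝ)

/-- **The new solid torus of the flat model as a map** `D̊² × S¹ → ℝ³`:
`(p, v) ↦ ψ (p, v) = flatTube (coreDir v) (fibreRot ε p v)`. [folklore] -/
def psiFlatS (h ε δ : ℝ) (b : solidTorus) : 𝔼 3 :=
  psiFlat h ε δ (b : (𝔼 2) × (𝕊 1)).1 (b : (𝔼 2) × (𝕊 1)).2

/-- `ψ` on points. [folklore] -/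
theorem psiFlatS_apply (h ε δ : ℝ) (b : solidTorus) :
    psiFlatS h ε δ b = psiFlat h ε δ (b : (𝔼 2) × (𝕊 1)).1 (b : (𝔼 2) × (𝕊 1)).2 := rfl

variable {δ}

/-- `ψ = flatTubeS ∘ swap ∘ torusTwistFun`. [folklore] -/
theorem psiFlatS_eq_comp (hh : h ^ 2 = 1) (he : ε ^ 2 = 1) :
    psiFlatS h ε δ = flatTubeS h δ ∘ Prod.swap ∘ torusTwistFun hh he := rfl

/-- Local notation: the model with corners of `S¹ × ℝ²`. -/
local notation "𝓘₁₂" => (ModelWithCorners.prod (𝓡 1) 𝓘(ℝ, EuclideanSpace ℝ (Fin 2)))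

/-- **`ψ` is a local diffeomorphism** at every point of the open solid torus (composition of the
twist of the solid torus, the factor swap and the flat tube). [folklore] -/
theorem isLocalDiffeomorph_psiFlatS (hh : h ^ 2 = 1) (he : ε ^ 2 = 1) (hδ : 0 < δ)
    (hδ4 : δ ≤ 1 / 4) : IsLocalDiffeomorph 𝓘₂₁ 𝓘(ℝ, 𝔼 3) ∞ (psiFlatS h ε δ) := by
  intro b
  rw [psiFlatS_eq_comp hh he]
  have h1 := isLocalDiffeomorph_torusTwistFun hh he b
  have h2 : IsLocalDiffeomorphAt 𝓘₂₁ 𝓘₁₂ ∞ (Prod.swap : (𝔼 2) × (𝕊 1) → (𝕊 1) × 𝔼 2)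
      (torusTwistFun hh he b) :=
    (Diffeomorph.prodComm 𝓘(ℝ, 𝔼 2) (𝓡 1) (𝔼 2) (𝕊 1) ∞).isLocalDiffeomorph _
  have h3 := isLocalDiffeomorph_flatTubeS hh hδ hδ4 (Prod.swap (torusTwistFun hh he b))
  exact IsLocalDiffeomorphAt.comp (hf := IsLocalDiffeomorphAt.comp (hf := h1) (hg := h2)) (hg := h3)

/-- `ψ` is smooth. [folklore] -/
theorem contMDiff_psiFlatS (hh : h ^ 2 = 1) (he : ε ^ 2 = 1) (hδ : 0 < δ) (hδ4 : δ ≤ 1 / 4) :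
    ContMDiff 𝓘₂₁ 𝓘(ℝ, 𝔼 3) ∞ (psiFlatS h ε δ) :=
  (isLocalDiffeomorph_psiFlatS hh he hδ hδ4).contMDiff

/-- **`ψ` is injective** on the open solid torus. [folklore] -/
theorem psiFlatS_injective (hh : h ^ 2 = 1) (he : ε ^ 2 = 1) (hδ : 0 < δ) (hδ4 : δ ≤ 1 / 4) :
    Injective (psiFlatS h ε δ) := by
  rw [psiFlatS_eq_comp hh he]
  refine (flatTubeS_injective hh hδ hδ4).comp (Prod.swap_injective.comp ?_)
  exact (LeftInverse.injective fun b ↦ (torusTwistPD hh he).left_inv (mem_univ b))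

/-- The image of `ψ` lies in the tube `{‖(a, z)‖ < δ}`. [folklore] -/
theorem norm_az_psiFlatS_lt (hh : h ^ 2 = 1) (he : ε ^ 2 = 1) (hδ : 0 < δ) (hδ4 : δ ≤ 1 / 4)
    (b : solidTorus) : ‖az (psiFlatS h ε δ b)‖ < δ := by
  rw [psiFlatS_eq_comp hh he, comp_apply, comp_apply]
  exact (flatTubePD hh hδ hδ4).map_source (mem_univ _)

end SolidTorusTwist

end BlowDownFlat

end Literature.Topology.FourManifolds
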